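import Mathlib
import Literature.Analysis.Convex.AndersonAccelerationPDHG
import HarnessLib

/-!
# Over-relaxed PDHG (`z⁺ = z + ρ (PD(z) − z)`, `ρ ∈ (0, 2)`) and variable-step (adaptive / primal-weight)
# PDHG: convergence to a saddle point, the summed residual bound, and the `O(1/(ρN))` ergodic rate

Topic `Literature/Analysis/Convex` (companion of `PrimalDualHybridGradient.lean` — `pdhgStep`, the KKT
operator `kkt`, the metric `M_{τ,σ}` = `metricM`, `fejer_step`, `conicL_step_le`, `xAvg`/`yAvg`;
`RestartedPDHG.lean` — `qM`/`bM`/`normM`; `AndersonAccelerationPDHG.lean` — equivalent Euclidean gauges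
`IsEuclideanGauge`, `isEuclideanGauge_normM`, `normM_pdhgStep_firm`). Namespace
`Literature.Analysis.Convex.RelaxedPDHG`. Everything PROVED; no named facts, no `sorry`.
The header of `PrimalDualHybridGradient.lean` lists "over-relaxation … `θ ≠ 1`; restarts" as
deliberately not typed there; this file types OVER-RELAXATION and VARIABLE STEP SIZES.

Sources (all held and read at the page).
[CP16] A. Chambolle, T. Pock, *On the ergodic convergence rates of a first-order primal–dual
algorithm*, Math. Program. 159 (2016) 253–287 [ChambollePock2015] (`paper:doi-10-1007-s10107-015-0957-3`,
PDF p. 9: §4.1 "Relaxed primal-dual algorithm", Algorithm 2 (22)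
`(ξ^{n+1}, η^{n+1}) = PD_{τ,σ}(x^n, y^n, 2ξ^{n+1} − x^n, y^n)`, `z^{n+1} = (1 − ρ_n) z^n + ρ_n ζ^{n+1}`;
p. 10: "whose convergence has been considered already in [14, 16]. It is known that an overrelaxation
parameter close to 2 can speed up the convergence"; THEOREM 2: "Let the step size parameters `τ, σ > 0`
and the overrelaxation parameter `ρ_n` be a non-decreasing sequence in `(0, ρ)` with `ρ < 2` such that
… `(1/τ − L_f/(2−ρ)) (1/σ) > ‖K‖²` (23). Then, for any `z = (x, y) ∈ X × Y` it holds that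
`L(X^N, y) − L(x, Y^N) ≤ ‖z − z⁰‖²_{M_{τ,σ}} / (2ρ₀N)` (24), where `X^N = N⁻¹ Σ_{n=1}^N ξ^n`,
`Y^N = N⁻¹ Σ_{n=1}^N η^n`"; proof p. 10–11: `ζ^{n+1} = z^n + ρ_n⁻¹ (z^{n+1} − z^n)` and the per-step
inequality `≤ (2ρ_n)⁻¹ (‖z − z^n‖²_M − ‖z − z^{n+1}‖²_M) − (2−ρ_n)/(2ρ_n²) ‖z^{n+1} − z^n‖²_M`).
[EB92] J. Eckstein, D. P. Bertsekas, Math. Program. 55 (1992) 293–318 [EcksteinBertsekas1992]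
(`paper:doi-10-1007-bf01581204`, p. 299, THEOREM 3 — the generalized proximal point algorithm
`z^{k+1} = (1 − ρ_k) z^k + ρ_k w^k`, `‖w^k − (I + c_k T)⁻¹(z^k)‖ ≤ ε_k`, `Σ ε_k < ∞`, `inf ρ_k > 0`,
`sup ρ_k < 2`, `inf c_k > 0`: "if `T` possesses any zero, `{z^k}` converges weakly to a zero of `T`";
this is reference [14] of [CP16], and one PDHG step is a proximal-point step for the KKT operator in the
metric `M_{τ,σ}` — [CP16, §3 (12)], [16] = [HeYuan2012]).
[GLYEB] T. Goldstein, M. Li, X. Yuan, E. Esser, R. Baraniuk, *Adaptive primal-dual hybrid gradient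
methods for saddle-point problems*, arXiv:1305.0546 (v2, 2015) [GoldsteinEtAl2013] (held as
`paper:arxiv-1305.0546`; read in the LaTeX source: §6.2 "Stepsize Conditions" (A) "The sequences `{τ_k}`
and `{σ_k}` are bounded", (B) "The sequence `{φ_k}` is summable", where
`φ_k = max{(τ_k − τ_{k+1})/τ_k, (σ_k − σ_{k+1})/σ_k, 0}` "quantifies the relative decrease in the
stepsizes", (C1) "`τ_k σ_k < L < ρ(AᵀA)⁻¹`"; §6.6 Lemma 1 (two-sided comparison of `‖·‖_{M}` with
`‖x‖²/τ + ‖y‖²/σ`, constant `1 ± √(τσ‖AᵀA‖)`), Lemma (Fejér in `M_k`)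
`‖u_k − u*‖²_{M_k} − ‖u_{k+1} − u*‖²_{M_k} ≥ ‖u_{k+1} − u_k‖²_{M_k}`; §6.7 THEOREM 1: "Suppose that the
stepsizes … satisfy conditions (A) and (B), and either (C1) or (C2). Then the algorithm converges in the
residuals, i.e. `lim_k ‖P_k‖² + ‖D_k‖² = 0`" (proof: `Σ_k ‖u_{k+1} − u_k‖²_{M_k} < ∞`); §5.1 Algorithm 2
"Adaptive PDHG" = residual balancing (§4) with `τ_kσ_k` constant and geometrically decreasing
adaptivity `α_{k+1} = η α_k`, which satisfies (A), (B), (C1) (§6.3); §2 Algorithm 1 = basic PDHG with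
steps `τ_k, σ_k`).
[CV13] P. L. Combettes, B. C. Vũ, *Variable metric quasi-Fejér monotonicity*, Nonlinear Anal. 78 (2013)
17–31 = arXiv:1206.5705 [CombettesVu2013] (held; §2 Lemma 2.2 [Polyak]: "`α_{n+1} ≤ (1+η_n)α_n + ε_n`
with `(η_n), (ε_n) ∈ ℓ¹₊` ⇒ `(α_n)` converges"; §3 Definition 3.1 (quasi-Fejér monotone w.r.t. `C`
relative to variable metrics `(W_n)`: `‖x_{n+1} − z‖_{W_{n+1}} ≤ (1+η_n)‖x_n − z‖_{W_n} + ε_n`),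
Proposition 3.2 (`‖x_n − z‖_{W_n}` converges, `(x_n)` bounded), Theorem 3.3 (convergence iff every
cluster point lies in `C`)).

WHAT IS TYPED.

§1 Real sequences and one relaxed step in a gauge. `le_exp_mul_of_le_mul_add` / **`exists_tendsto_of_le_mul_add`**
= [CV13, Lemma 2.2]; `gauge_relaxStep_sq_le`: for `f` FIRMLY quasi-nonexpansive towards `y` in an
equivalent Euclidean gauge `N` and `0 ≤ ρ`,
`N(z + ρ(fz − z) − y)² ≤ N(z − y)² − ρ(2−ρ) N(fz − z)²` (the relaxed proximal-point inequality).

§2 **`exists_tendsto_of_firm_varGauge`** — the convergence engine, [CV13, Prop 3.2 / Thm 3.3] in finite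
dimension (proper space) combined with [EB92, Thm 3]: gauges `N_k` with UNIFORM equivalence constants and
`N_{k+1}(d)² ≤ (1 + η_k) N_k(d)²`, `Σ η_k < ∞`; maps `f_k` firmly quasi-nonexpansive in `N_k` towards a
common nonempty target set `F`; relaxations `ρ_k ∈ [ρlo, ρhi] ⊂ (0, 2)`; the iteration
`x^{k+1} = x^k + ρ_k (f_k x^k − x^k)`; and the closure hypothesis "a cluster point along which
`f_k x^k − x^k → 0` lies in `F`" ⇒ `x^k → x̄ ∈ F`. Also `summable_gauge_resid_sq` (`Σ N_k(f_k x^k − x^k)² < ∞`)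
and `tendsto_resid_of_firm_varGauge`. Fixed gauge and map: **`exists_tendsto_relaxed_of_firm`** =
[EB92, Thm 3] with exact resolvents (`ε_k = 0`) for a continuous firmly quasi-nonexpansive map on a
proper space.

§3 RELAXED PDHG with fixed `(τ, σ)`: `relaxedPdhgIter` (= [CP16, Algorithm 2 (22)] with `θ = 1`,
`L_f = 0`), **`tendsto_relaxedPdhgIter`** (finite dimension, monotone `A`, `B` with resolvent maps,
`τσ‖K‖² < 1`, a saddle point exists, `ρ_k ∈ [ρlo, ρhi] ⊂ (0,2)` ⇒ `z^k →` a saddle point) and its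
conic / projection form `tendsto_relaxedPdhgIter_conic`; the summed Fejér bound
**`sum_relaxed_residual_le`**: `Σ_{k<K} ρ_k(2−ρ_k) ‖PD(z^k) − z^k‖²_M ≤ ‖z⁰ − z*‖²_M` (`τσ‖K‖² ≤ 1`,
`0 ≤ ρ_k ≤ 2`).

§4 [CP16, THEOREM 2] for `L_f = 0` (the constrained bilinear / conic saddle of the tree's
`conicL`): `conicL_relaxed_step_le` (the per-step inequality of the printed proof, multiplied by `ρ_n`)
and **`conicL_gap_ergodic_relaxed_le`**: for `τσ‖K‖² ≤ 1`, `ρ_n` non-decreasing with `0 < ρ_n ≤ 2`,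
every `(x, y) ∈ C × D` and `N ≥ 1`,
`L(X_N, y) − L(x, Y_N) ≤ ‖z⁰ − (x,y)‖²_M / (2ρ₀N)` with `X_N`, `Y_N` the averages of the PD points
`ζ^n = PD(z^{n−1})`, `n = 1..N`.

§5 VARIABLE STEPS [GLYEB, Thm 1 under (A), (B), (C1)], with relaxation allowed: `varPdhgIter`
(`z^{k+1} = z^k + ρ_k (PD_{τ_k,σ_k}(z^k) − z^k)`, resolvent maps `jA_k = J_{τ_k A}`, `jB_k = J_{σ_k B}`),
`stepDecrease` (= the printed `φ_k`), `qM_sub_qM` (how `‖·‖²_{M_{τ,σ}}` changes with `(τ, σ)`),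
`qM_succ_le` (`‖d‖²_{M_{k+1}} ≤ (1 + 2φ_k/(1−√ℓ)) ‖d‖²_{M_k}` once `φ_k ≤ ½`), `isClosed_of_isResolventMap`
and `mem_zer_kkt_of_tendsto` (closed graphs ⇒ limits of approximate KKT pairs are saddle points), and
**`tendsto_varPdhgIter`**: finite dimension; `A`, `B` monotone; `0 < τlo ≤ τ_k ≤ τhi`,
`0 < σlo ≤ σ_k ≤ σhi` [(A)]; `τ_kσ_k‖K‖² ≤ ℓ < 1` [(C1)]; `Σ φ_k < ∞` [(B)]; `ρ_k ∈ [ρlo, ρhi] ⊂ (0,2)`;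
a saddle point exists ⇒ `z^k → z*` a saddle point; **`tendsto_varPdhgIter_sub`** (the printed conclusion
"converges in the residuals": `z^{k+1} − z^k → 0`); conic form `tendsto_varPdhgIter_conic`; and the
PRIMAL-WEIGHT form **`tendsto_varPdhgIter_primalWeight`** (`τ_k = s/ω_k`, `σ_k = sω_k`, `s²‖K‖² < 1`,
`ω_k ∈ [ωlo, ωhi]`, `Σ|ω_{k+1} − ω_k| < ∞` ⇒ convergence; [GLYEB, Alg. 2] keeps `τ_kσ_k` constant exactly so).

§6 INEXACT STEPS (summable resolvent errors): `gauge_relaxStep_le`, `gauge_inexact_succ_le(_mul)`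
(`N_{k+1}(x^{k+1} − y) ≤ (1+η_k)N_k(x^k − y) + 2(1+η_k)ε_k` when `N_k(w^k − f_k x^k) ≤ ε_k`),
`gauge_inexact_bound`, `summable_gauge_resid_sq_inexact`, **`exists_tendsto_of_firm_varGauge_inexact`**
(the engine with `Σ ε_k < ∞`), **`exists_tendsto_relaxed_of_firm_inexact`** = [EB92, Thm 3] WITH its
error sequence `ε_k` (finite dimension); **`tendsto_of_inexact_relaxedPdhg`** (over-relaxed PDHG whose PD
points are evaluated up to `‖w^k − PD(z^k)‖ ≤ ε_k`, `Σε_k < ∞` ⇒ convergence to a saddle point); and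
**`exists_tendsto_of_inexact_drIter`** = [EB92, THEOREM 7] (generalized Douglas–Rachford splitting with
relaxation factors `ρ_k` AND approximate resolvents `‖u^k − J_{λB}z^k‖ ≤ β_k`,
`‖v^{k+1} − J_{λA}(2u^k − z^k)‖ ≤ α_k`, `Σα_k, Σβ_k < ∞`; the tree's
`DouglasRachfordSplitting.exists_tendsto_kmIter_drStep` was the case `α_k = β_k = 0`, constant `ρ`).

§7 `varPdhgPoint`, **`conicL_gap_ergodic_var_le`** — the ergodic `O(1/N)` gap under VARIABLE steps
([GLYEB, Thm 2]-type, conic case, constant relaxation `0 < ρ ≤ 2`): with `M_k ⪰ 0`,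
`‖d‖²_{M_{k+1}} ≤ (1+κ_k)‖d‖²_{M_k}` and `‖z^k − (x,y)‖²_{M_k} ≤ Dmax`,
`L(X_N, y) − L(x, Y_N) ≤ (‖z⁰ − (x,y)‖²_{M_0} + Dmax Σ_{k<N} κ_k)/(2ρN)` — the DEGRADATION of [CP16, Thm 2]'s
constant by the (summable) metric variation.

§8 **`normM_pdhgStep_two_point`** / `normM_pdhgStep_sub_pdhgStep_le` — the PDHG step is FIRMLY
NONEXPANSIVE in `‖·‖_M` between any two points (`‖PD u − PD v‖²_M + ‖(u − PD u) − (v − PD v)‖²_M ≤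
‖u − v‖²_M`, `τσ‖K‖² ≤ 1`): the resolvent property of the proximal-point form [CP16, (12)]; the earlier
files had the quasi form towards saddle points only (`fejer_step`, `normM_pdhgStep_firm`).

§9 `summable_abs_sub_of_antitone` and **`tendsto_varPdhgIter_primalWeight_antitone`** — a
RATCHETED (non-increasing, floored) primal weight satisfies (A), (B), (C1) automatically (fixed `s`), so
convergence needs no summability check.

Deviations / honesty. (i) [EB92, Thm 3/Thm 7] and [CV13] are stated in Hilbert space with weak
convergence (and, for Thm 3, variable `c_k` with `inf c_k > 0`); typed: finite dimension (proper space),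
strong convergence, fixed `c` — the error sequences ARE typed (§6). (ii) [CP16,
Thm 2] is printed for `ρ_n ∈ (0, ρ̄)`, `ρ̄ < 2`, and the strict (23); with `L_f = 0` the proof needs only
`0 < ρ_n ≤ 2` non-decreasing and `τσ‖K‖² ≤ 1` (`M_{τ,σ} ⪰ 0`), which is what is typed. (iii) [GLYEB,
Thm 1] has `ρ_k ≡ 1` and concludes residual convergence; the relaxation factor and the convergence OF
THE ITERATES to a saddle point (the finite-dimensional consequence of the same variable-metric Fejér
inequality, [CV13, Thm 3.3]) are additions of this file, proved here, not claims of [GLYEB]; the floors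
`τlo, σlo > 0` are assumed explicitly (under (A)+(B) they follow from `τ_{k+1} ≥ (1−φ_k)τ_k`,
`Π(1−φ_k) > 0`). -- TODO(general form): derive the floors from (A)+(B); weak convergence in Hilbert space.
(iv) NOT covered, and NOT a theorem in print: step rules whose relative decreases are not summable
(PDLP's adaptive step size; primal-weight smoothing `ω ← exp(θ log(Δx/Δy) + (1−θ) log ω)` applied at
every restart with constant `θ`); a primal-weight schedule that is eventually frozen, or whose relative
changes are summable (e.g. [GLYEB, Alg. 2]: adaptivity `α_{k+1} = ηα_k`), IS covered by §5. No rates are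
claimed in §5 (none printed beyond [GLYEB, Thm 2]'s ergodic VI bound, not typed). Floating point is not
modelled.
-/

namespace Literature.Analysis.Convex.RelaxedPDHG

open _root_.Filter _root_.Topology Finset
open scoped RealInnerProductSpace
open Literature.Analysis.Convex.AndersonAccelerationPDHG (IsEuclideanGauge)
open Literature.Analysis.Convex.ProximalPointAlgorithm (exists_tendsto_of_le_add_of_summable
  tendsto_zero_of_le_add_of_summable)

/-! ## §1 Real sequences ([CV13, Lemma 2.2]) and one relaxed step in an equivalent Euclidean gauge -/

section RealSequences

variable {a η ε : ℕ → ℝ}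

/-- The product bound behind [CV13, Lemma 2.2]: if `a_n, η_n, ε_n ≥ 0` and
`a_{n+1} ≤ (1 + η_n) a_n + ε_n`, then `a_n ≤ exp(Σ_{i<n} η_i) · (a_0 + Σ_{i<n} ε_i)`.
[cite: CombettesVu2013, §2 Lemma 2.2] -/
theorem le_exp_sum_mul_of_le_mul_add (ha : ∀ n, 0 ≤ a n) (hη : ∀ n, 0 ≤ η n) (hε : ∀ n, 0 ≤ ε n)
    (h : ∀ n, a (n + 1) ≤ (1 + η n) * a n + ε n) (n : ℕ) :
    a n ≤ Real.exp (∑ i ∈ Finset.range n, η i) * (a 0 + ∑ i ∈ Finset.range n, ε i) := by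
  induction n with
  | zero => simp
  | succ n ih =>
    have hS : 0 ≤ ∑ i ∈ Finset.range n, η i := Finset.sum_nonneg fun i _ => hη i
    have hE : 0 ≤ a 0 + ∑ i ∈ Finset.range n, ε i :=
      add_nonneg (ha 0) (Finset.sum_nonneg fun i _ => hε i)
    have h1 : 1 + η n ≤ Real.exp (η n) := by linarith [Real.add_one_le_exp (η n)]
    have h2 : 1 ≤ Real.exp (∑ i ∈ Finset.range (n + 1), η i) :=
      Real.one_le_exp (Finset.sum_nonneg fun i _ => hη i)
    have h3 : Real.exp (∑ i ∈ Finset.range (n + 1), η i) =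
        Real.exp (η n) * Real.exp (∑ i ∈ Finset.range n, η i) := by
      rw [Finset.sum_range_succ, Real.exp_add, mul_comm]
    calc a (n + 1) ≤ (1 + η n) * a n + ε n := h n
      _ ≤ Real.exp (η n) * (Real.exp (∑ i ∈ Finset.range n, η i) *
            (a 0 + ∑ i ∈ Finset.range n, ε i)) + ε n := by
          have := mul_le_mul h1 ih (ha n) (Real.exp_nonneg _)
          linarith
      _ = Real.exp (∑ i ∈ Finset.range (n + 1), η i) * (a 0 + ∑ i ∈ Finset.range n, ε i) + ε n := by
          rw [h3, mul_assoc]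
      _ ≤ Real.exp (∑ i ∈ Finset.range (n + 1), η i) * (a 0 + ∑ i ∈ Finset.range n, ε i) +
            Real.exp (∑ i ∈ Finset.range (n + 1), η i) * ε n := by
          have := mul_le_mul_of_nonneg_right h2 (hε n)
          linarith
      _ = Real.exp (∑ i ∈ Finset.range (n + 1), η i) * (a 0 + ∑ i ∈ Finset.range (n + 1), ε i) := by
          rw [Finset.sum_range_succ (fun i => ε i) n]; ring

/-- Uniform bound: `a_n ≤ exp(Σ η) · (a_0 + Σ ε)` for summable `η, ε ≥ 0`.
[cite: CombettesVu2013, §2 Lemma 2.2] -/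
theorem le_exp_tsum_mul_of_le_mul_add (ha : ∀ n, 0 ≤ a n) (hη : ∀ n, 0 ≤ η n) (hε : ∀ n, 0 ≤ ε n)
    (hηs : Summable η) (hεs : Summable ε) (h : ∀ n, a (n + 1) ≤ (1 + η n) * a n + ε n) (n : ℕ) :
    a n ≤ Real.exp (∑' i, η i) * (a 0 + ∑' i, ε i) := by
  refine (le_exp_sum_mul_of_le_mul_add ha hη hε h n).trans ?_
  have h1 : Real.exp (∑ i ∈ Finset.range n, η i) ≤ Real.exp (∑' i, η i) :=
    Real.exp_le_exp.2 (hηs.sum_le_tsum _ fun i _ => hη i)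
  have h2 : a 0 + ∑ i ∈ Finset.range n, ε i ≤ a 0 + ∑' i, ε i :=
    add_le_add le_rfl (hεs.sum_le_tsum _ fun i _ => hε i)
  exact mul_le_mul h1 h2 (add_nonneg (ha 0) (Finset.sum_nonneg fun i _ => hε i))
    (Real.exp_nonneg _)

/-- **[CV13, Lemma 2.2] (Polyak).** If `a_n, η_n, ε_n ≥ 0`, `Σ η_n < ∞`, `Σ ε_n < ∞` and
`a_{n+1} ≤ (1 + η_n) a_n + ε_n`, then `(a_n)` converges. (Bound `a_n ≤ B`, so
`a_{n+1} ≤ a_n + (η_n B + ε_n)` with a summable error, and the tree's Lemma 1.7 of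
`ProximalPointAlgorithm` applies.) [cite: CombettesVu2013, §2 Lemma 2.2] -/
theorem exists_tendsto_of_le_mul_add (ha : ∀ n, 0 ≤ a n) (hη : ∀ n, 0 ≤ η n) (hε : ∀ n, 0 ≤ ε n)
    (hηs : Summable η) (hεs : Summable ε) (h : ∀ n, a (n + 1) ≤ (1 + η n) * a n + ε n) :
    ∃ l, Tendsto a atTop (𝓝 l) := by
  set B : ℝ := Real.exp (∑' i, η i) * (a 0 + ∑' i, ε i) with hB
  have hB0 : 0 ≤ B := mul_nonneg (Real.exp_nonneg _) (add_nonneg (ha 0) (tsum_nonneg hε))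
  have hbd : ∀ n, a n ≤ B := le_exp_tsum_mul_of_le_mul_add ha hη hε hηs hεs h
  have hadd : ∀ n, a (n + 1) ≤ a n + (η n * B + ε n) := fun n => by
    have h1 := h n
    have h2 : η n * a n ≤ η n * B := mul_le_mul_of_nonneg_left (hbd n) (hη n)
    nlinarith
  exact exists_tendsto_of_le_add_of_summable ha
    (fun n => add_nonneg (mul_nonneg (hη n) hB0) (hε n)) hadd ((hηs.mul_right B).add hεs)

/-- If moreover a subsequence of `(a_n)` tends to `0`, then `a_n → 0`.
[cite: CombettesVu2013, §2 Lemma 2.2 and §3 Thm 3.3 (proof)] -/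
theorem tendsto_zero_of_le_mul_add (ha : ∀ n, 0 ≤ a n) (hη : ∀ n, 0 ≤ η n) (hε : ∀ n, 0 ≤ ε n)
    (hηs : Summable η) (hεs : Summable ε) (h : ∀ n, a (n + 1) ≤ (1 + η n) * a n + ε n)
    {φ : ℕ → ℕ} (hφ : StrictMono φ) (h0 : Tendsto (a ∘ φ) atTop (𝓝 0)) :
    Tendsto a atTop (𝓝 0) := by
  obtain ⟨l, hl⟩ := exists_tendsto_of_le_mul_add ha hη hε hηs hεs h
  have : l = 0 := tendsto_nhds_unique (hl.comp hφ.tendsto_atTop) h0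
  rwa [this] at hl

end RealSequences

section GaugeStep

variable {E : Type*} [NormedAddCommGroup E] [NormedSpace ℝ E] {N : E → ℝ} {m Mu : ℝ}

/-- **One relaxed step of a firmly quasi-nonexpansive map, in an equivalent Euclidean gauge.** If
`N(fz − y)² + N(z − fz)² ≤ N(z − y)²` (firm quasi-nonexpansiveness towards `y`, e.g. a resolvent /
proximal-point step [EB92, Thm 2]) and `0 ≤ ρ`, then for the relaxed point `z + ρ(fz − z)
= (1−ρ)z + ρ fz`: `N(z + ρ(fz − z) − y)² ≤ N(z − y)² − ρ(2−ρ) N(fz − z)²` — the inequality that makes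
relaxation factors `ρ ∈ (0, 2)` admissible. [cite: EcksteinBertsekas1992, §3 Thm 3 (proof)]
[cite: ChambollePock2015, §4.1 Thm 2 (proof: the term −(2−ρ_n)/(2ρ_n²)‖z^{n+1} − z^n‖²)] -/
theorem gauge_relaxStep_sq_le (hN : IsEuclideanGauge N m Mu) {f : E → E} {ρ : ℝ} (hρ0 : 0 ≤ ρ)
    {y z : E} (hfirm : N (f z - y) ^ 2 + N (z - f z) ^ 2 ≤ N (z - y) ^ 2) :
    N ((z + ρ • (f z - z)) - y) ^ 2 ≤ N (z - y) ^ 2 - ρ * (2 - ρ) * N (f z - z) ^ 2 := by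
  have h1 : (z + ρ • (f z - z)) - y = (1 - ρ) • (z - y) + ρ • (f z - y) := by module
  have h2 : (z - y) - (f z - y) = -(f z - z) := by abel
  have h3 : N (z - f z) = N (f z - z) := by rw [← hN.map_neg, neg_sub]
  rw [h1, hN.sq_convex, h2, hN.map_neg]
  rw [h3] at hfirm
  have h4 : ρ * N (f z - y) ^ 2 ≤ ρ * (N (z - y) ^ 2 - N (f z - z) ^ 2) :=
    mul_le_mul_of_nonneg_left (by linarith) hρ0
  nlinarith [h4]

/-- Weakening the constants of an equivalent Euclidean gauge: `0 < m' ≤ m`, `Mu ≤ Mu'`.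
[cite: ChambollePock2015, §3 (12)–(13)] -/
theorem isEuclideanGauge_of_le (hN : IsEuclideanGauge N m Mu) {m' Mu' : ℝ} (hm' : 0 < m')
    (hmm : m' ≤ m) (hMu : Mu ≤ Mu') : IsEuclideanGauge N m' Mu' where
  m_pos := hm'
  Mu_nonneg := hN.Mu_nonneg.trans hMu
  lower d := (mul_le_mul_of_nonneg_right hmm (norm_nonneg d)).trans (hN.lower d)
  upper d := (hN.upper d).trans (mul_le_mul_of_nonneg_right hMu (norm_nonneg d))
  smul := hN.smul
  add_le := hN.add_le
  sq_convex := hN.sq_convex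

end GaugeStep

/-! ## §2 The convergence engine: relaxed steps of firmly quasi-nonexpansive maps in a variable
equivalent Euclidean gauge ([CV13, Prop 3.2 / Thm 3.3] in finite dimension ∘ [EB92, Thm 3]) -/

section Engine

variable {E : Type*} [NormedAddCommGroup E] [NormedSpace ℝ E]
variable {N : ℕ → E → ℝ} {m Mu : ℝ} {η : ℕ → ℝ} {F : Set E} {f : ℕ → E → E} {ρ : ℕ → ℝ}
  {ρlo ρhi : ℝ} {x : ℕ → E}

/-- **The variable-metric Fejér inequality of the relaxed scheme.** With gauges `N_k` satisfying
`N_{k+1}(d)² ≤ (1+η_k) N_k(d)²`, maps `f_k` firmly quasi-nonexpansive in `N_k` towards `y`, relaxations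
`ρ_k ∈ [ρlo, ρhi] ⊂ [0, 2]` and `x^{k+1} = x^k + ρ_k(f_k x^k − x^k)`:
`N_{k+1}(x^{k+1} − y)² + ρlo(2−ρhi)·N_k(f_k x^k − x^k)² ≤ (1 + η_k) N_k(x^k − y)²`.
[cite: CombettesVu2013, §3 Definition 3.1 (φ = |·|²)] [cite: GoldsteinEtAl2013, §6.6 Lemma (Fejér inequality in M_k) and §6.7 Thm 1 (proof)]
[cite: EcksteinBertsekas1992, §3 Thm 3 (proof)] -/
theorem gauge_sq_succ_add_le (hN : ∀ k, IsEuclideanGauge (N k) m Mu) (hη : ∀ k, 0 ≤ η k)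
    (hmono : ∀ k d, N (k + 1) d ^ 2 ≤ (1 + η k) * N k d ^ 2) (hρlo : 0 ≤ ρlo) (hρhi : ρhi ≤ 2)
    (hρ : ∀ k, ρlo ≤ ρ k ∧ ρ k ≤ ρhi) (hx : ∀ k, x (k + 1) = x k + ρ k • (f k (x k) - x k))
    {y : E} (hfirm : ∀ k z, N k (f k z - y) ^ 2 + N k (z - f k z) ^ 2 ≤ N k (z - y) ^ 2) (k : ℕ) :
    N (k + 1) (x (k + 1) - y) ^ 2 + ρlo * (2 - ρhi) * N k (f k (x k) - x k) ^ 2 ≤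
      (1 + η k) * N k (x k - y) ^ 2 := by
  obtain ⟨h1, h2⟩ := hρ k
  have hstep : N k (x (k + 1) - y) ^ 2 ≤
      N k (x k - y) ^ 2 - ρ k * (2 - ρ k) * N k (f k (x k) - x k) ^ 2 := by
    rw [hx k]
    exact gauge_relaxStep_sq_le (hN k) (hρlo.trans h1) (hfirm k (x k))
  have hc : ρlo * (2 - ρhi) ≤ ρ k * (2 - ρ k) := by nlinarith
  have hr : 0 ≤ N k (f k (x k) - x k) ^ 2 := sq_nonneg _
  have hm := hmono k (x (k + 1) - y)
  have hc0 : 0 ≤ ρlo * (2 - ρhi) := mul_nonneg hρlo (by linarith)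
  have hcr := mul_le_mul_of_nonneg_right hc hr
  have h3 : N k (x (k + 1) - y) ^ 2 ≤
      N k (x k - y) ^ 2 - ρlo * (2 - ρhi) * N k (f k (x k) - x k) ^ 2 := by linarith
  have h4 := mul_le_mul_of_nonneg_left h3 (by linarith [hη k] : (0 : ℝ) ≤ 1 + η k)
  have h5 : 0 ≤ η k * (ρlo * (2 - ρhi) * N k (f k (x k) - x k) ^ 2) :=
    mul_nonneg (hη k) (mul_nonneg hc0 hr)
  linarith

/-- Consequence 1: `N_k(x^k − y)²` is bounded, by `exp(Σ η) · N_0(x⁰ − y)²`.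
[cite: CombettesVu2013, §3 Prop 3.2 (i)–(ii)] [cite: GoldsteinEtAl2013, §6.6 Lemma (upper bound on ‖u_k − u*‖_{M_k})] -/
theorem gauge_sq_le_bound (hN : ∀ k, IsEuclideanGauge (N k) m Mu) (hη : ∀ k, 0 ≤ η k)
    (hηs : Summable η) (hmono : ∀ k d, N (k + 1) d ^ 2 ≤ (1 + η k) * N k d ^ 2) (hρlo : 0 ≤ ρlo)
    (hρhi : ρhi ≤ 2) (hρ : ∀ k, ρlo ≤ ρ k ∧ ρ k ≤ ρhi)
    (hx : ∀ k, x (k + 1) = x k + ρ k • (f k (x k) - x k)) {y : E}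
    (hfirm : ∀ k z, N k (f k z - y) ^ 2 + N k (z - f k z) ^ 2 ≤ N k (z - y) ^ 2) (k : ℕ) :
    N k (x k - y) ^ 2 ≤ Real.exp (∑' i, η i) * N 0 (x 0 - y) ^ 2 := by
  have h : ∀ n, N (n + 1) (x (n + 1) - y) ^ 2 ≤ (1 + η n) * N n (x n - y) ^ 2 + 0 := fun n => by
    have := gauge_sq_succ_add_le hN hη hmono hρlo hρhi hρ hx hfirm n
    have hc0 : 0 ≤ ρlo * (2 - ρhi) * N n (f n (x n) - x n) ^ 2 :=
      mul_nonneg (mul_nonneg hρlo (by linarith)) (sq_nonneg _)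
    linarith
  have := le_exp_tsum_mul_of_le_mul_add (a := fun n => N n (x n - y) ^ 2) (fun n => sq_nonneg _) hη
    (fun _ => le_rfl) hηs summable_zero h k
  simpa using this

/-- Consequence 2: **the gauge residuals are square-summable**, `Σ_k N_k(f_k x^k − x^k)² < ∞`
(for `ρlo > 0`, `ρhi < 2`). [cite: GoldsteinEtAl2013, §6.7 Thm 1 (proof: Σ‖u_{k+1} − u_k‖²_{M_k} < ∞)]
[cite: EcksteinBertsekas1992, §3 Thm 3 (proof)] -/
theorem summable_gauge_resid_sq (hN : ∀ k, IsEuclideanGauge (N k) m Mu) (hη : ∀ k, 0 ≤ η k)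
    (hηs : Summable η) (hmono : ∀ k d, N (k + 1) d ^ 2 ≤ (1 + η k) * N k d ^ 2) (hρlo : 0 < ρlo)
    (hρhi : ρhi < 2) (hρ : ∀ k, ρlo ≤ ρ k ∧ ρ k ≤ ρhi)
    (hx : ∀ k, x (k + 1) = x k + ρ k • (f k (x k) - x k)) {y : E}
    (hfirm : ∀ k z, N k (f k z - y) ^ 2 + N k (z - f k z) ^ 2 ≤ N k (z - y) ^ 2) :
    Summable fun k => N k (f k (x k) - x k) ^ 2 := by
  set c : ℝ := ρlo * (2 - ρhi) with hc
  have hc0 : 0 < c := mul_pos hρlo (by linarith)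
  set a : ℕ → ℝ := fun k => N k (x k - y) ^ 2 with ha
  set B : ℝ := Real.exp (∑' i, η i) * a 0 with hB
  have hbd : ∀ k, a k ≤ B := gauge_sq_le_bound hN hη hηs hmono hρlo.le hρhi.le hρ hx hfirm
  have hstep : ∀ k, c * N k (f k (x k) - x k) ^ 2 ≤ a k - a (k + 1) + η k * B := fun k => by
    have h := gauge_sq_succ_add_le hN hη hmono hρlo.le hρhi.le hρ hx hfirm k
    have h2 : η k * a k ≤ η k * B := mul_le_mul_of_nonneg_left (hbd k) (hη k)
    simp only [ha] at h2 ⊢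
    linarith
  have hB0 : 0 ≤ B := le_trans (sq_nonneg _) (hbd 0)
  have hsum : ∀ K, ∑ k ∈ Finset.range K, c * N k (f k (x k) - x k) ^ 2 ≤ a 0 + B * ∑' i, η i := by
    intro K
    have htel : ∑ k ∈ Finset.range K, c * N k (f k (x k) - x k) ^ 2 ≤
        a 0 - a K + B * ∑ k ∈ Finset.range K, η k := by
      induction K with
      | zero => simp
      | succ K ih =>
        rw [Finset.sum_range_succ, Finset.sum_range_succ]
        have := hstep K
        linarith
    have h1 : ∑ k ∈ Finset.range K, η k ≤ ∑' i, η i := hηs.sum_le_tsum _ fun i _ => hη i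
    have h2 : 0 ≤ a K := sq_nonneg _
    nlinarith [mul_le_mul_of_nonneg_left h1 hB0]
  have hs : Summable fun k => c * N k (f k (x k) - x k) ^ 2 :=
    summable_of_sum_range_le (fun k => mul_nonneg hc0.le (sq_nonneg _)) hsum
  have := hs.mul_left c⁻¹
  simpa [← mul_assoc, inv_mul_cancel₀ hc0.ne'] using this

/-- Consequence 3: the residuals tend to zero, `f_k x^k − x^k → 0` (and so `x^{k+1} − x^k → 0`).
[cite: GoldsteinEtAl2013, §6.7 Thm 1 (lim ‖u_{k+1} − u_k‖ = 0)] [cite: EcksteinBertsekas1992, §3 Thm 3 (proof)] -/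
theorem tendsto_resid_of_firm_varGauge (hN : ∀ k, IsEuclideanGauge (N k) m Mu) (hη : ∀ k, 0 ≤ η k)
    (hηs : Summable η) (hmono : ∀ k d, N (k + 1) d ^ 2 ≤ (1 + η k) * N k d ^ 2) (hρlo : 0 < ρlo)
    (hρhi : ρhi < 2) (hρ : ∀ k, ρlo ≤ ρ k ∧ ρ k ≤ ρhi)
    (hx : ∀ k, x (k + 1) = x k + ρ k • (f k (x k) - x k)) {y : E}
    (hfirm : ∀ k z, N k (f k z - y) ^ 2 + N k (z - f k z) ^ 2 ≤ N k (z - y) ^ 2) :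
    Tendsto (fun k => f k (x k) - x k) atTop (𝓝 0) := by
  have hs := (summable_gauge_resid_sq hN hη hηs hmono hρlo hρhi hρ hx hfirm).tendsto_atTop_zero
  have hN0 : Tendsto (fun k => N k (f k (x k) - x k)) atTop (𝓝 0) := by
    have := hs.sqrt
    simpa [Real.sqrt_sq ((hN _).nonneg _)] using this
  rw [tendsto_iff_norm_sub_tendsto_zero]
  simp only [sub_zero]
  have hm : 0 < m := (hN 0).m_pos
  refine squeeze_zero (fun k => norm_nonneg _) (fun k => (hN k).norm_le _) ?_
  have := hN0.div_const m
  rwa [zero_div] at this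

/-- **THE ENGINE.** On a proper real normed space let `N_k` be equivalent Euclidean gauges with
UNIFORM constants `m, Mu`, `N_{k+1}(d)² ≤ (1+η_k)N_k(d)²`, `η_k ≥ 0` summable [CV13, Def 3.1]; let
`F ≠ ∅` and `f_k` be firmly quasi-nonexpansive in `N_k` towards every point of `F`; `ρ_k ∈ [ρlo, ρhi]`,
`0 < ρlo`, `ρhi < 2` [EB92, Thm 3]; `x^{k+1} = x^k + ρ_k (f_k x^k − x^k)`; and suppose every cluster
point `q` of `(x^k)` along a subsequence on which `f_k x^k − x^k → 0` lies in `F`. Then `x^k → x̄` for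
some `x̄ ∈ F`. (Proof = [CV13, Prop 3.2 + Thm 3.3] in finite dimension: bounded ⇒ cluster point `q ∈ F`;
`N_k(x^k − q)²` is quasi-Fejér hence convergent, and `→ 0` along the subsequence.)
[cite: CombettesVu2013, §3 Prop 3.2 and Thm 3.3] [cite: EcksteinBertsekas1992, §3 Thm 3] -/
theorem exists_tendsto_of_firm_varGauge [ProperSpace E] (hN : ∀ k, IsEuclideanGauge (N k) m Mu)
    (hη : ∀ k, 0 ≤ η k) (hηs : Summable η)
    (hmono : ∀ k d, N (k + 1) d ^ 2 ≤ (1 + η k) * N k d ^ 2) (hF : F.Nonempty)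
    (hfirm : ∀ k, ∀ y ∈ F, ∀ z, N k (f k z - y) ^ 2 + N k (z - f k z) ^ 2 ≤ N k (z - y) ^ 2)
    (hρlo : 0 < ρlo) (hρhi : ρhi < 2) (hρ : ∀ k, ρlo ≤ ρ k ∧ ρ k ≤ ρhi)
    (hx : ∀ k, x (k + 1) = x k + ρ k • (f k (x k) - x k))
    (hclos : ∀ (q : E) (φ : ℕ → ℕ), StrictMono φ → Tendsto (x ∘ φ) atTop (𝓝 q) →
      Tendsto (fun j => f (φ j) (x (φ j)) - x (φ j)) atTop (𝓝 0) → q ∈ F) :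
    ∃ q ∈ F, Tendsto x atTop (𝓝 q) := by
  have hm : 0 < m := (hN 0).m_pos
  have hMu : 0 ≤ Mu := (hN 0).Mu_nonneg
  obtain ⟨y, hy⟩ := hF
  have hfy : ∀ k z, N k (f k z - y) ^ 2 + N k (z - f k z) ^ 2 ≤ N k (z - y) ^ 2 :=
    fun k z => hfirm k y hy z
  have hres := tendsto_resid_of_firm_varGauge hN hη hηs hmono hρlo hρhi hρ hx hfy
  -- boundedness in the norm of `E`, and a cluster point
  set B : ℝ := Real.exp (∑' i, η i) * N 0 (x 0 - y) ^ 2 with hB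
  have hbdN : ∀ k, N k (x k - y) ^ 2 ≤ B := gauge_sq_le_bound hN hη hηs hmono hρlo.le hρhi.le hρ hx hfy
  have hB0 : 0 ≤ B := le_trans (sq_nonneg _) (hbdN 0)
  have hbd : ∀ k, x k ∈ Metric.closedBall y (Real.sqrt B / m) := fun k => by
    rw [Metric.mem_closedBall, dist_eq_norm]
    refine ((hN k).norm_le _).trans (div_le_div_of_nonneg_right ?_ hm.le)
    exact Real.le_sqrt_of_sq_le (hbdN k)
  obtain ⟨q, -, φ, hφ, hlim⟩ := tendsto_subseq_of_bounded Metric.isBounded_closedBall hbd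
  -- the cluster point is in `F`
  have hq : q ∈ F := hclos q φ hφ hlim (hres.comp hφ.tendsto_atTop)
  -- quasi-Fejér towards `q`
  have hfq : ∀ k z, N k (f k z - q) ^ 2 + N k (z - f k z) ^ 2 ≤ N k (z - q) ^ 2 :=
    fun k z => hfirm k q hq z
  set a : ℕ → ℝ := fun k => N k (x k - q) ^ 2 with ha
  set B' : ℝ := Real.exp (∑' i, η i) * a 0 with hB'
  have hbd' : ∀ k, a k ≤ B' := gauge_sq_le_bound hN hη hηs hmono hρlo.le hρhi.le hρ hx hfq
  have hB'0 : 0 ≤ B' := le_trans (sq_nonneg _) (hbd' 0)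
  have hrec : ∀ k, a (k + 1) ≤ (1 + η k) * a k + 0 := fun k => by
    have h := gauge_sq_succ_add_le hN hη hmono hρlo.le hρhi.le hρ hx hfq k
    have hc0 : 0 ≤ ρlo * (2 - ρhi) * N k (f k (x k) - x k) ^ 2 :=
      mul_nonneg (mul_nonneg hρlo.le (by linarith)) (sq_nonneg _)
    simp only [ha]
    linarith
  -- along `φ`, `a → 0`
  have hsub : Tendsto (a ∘ φ) atTop (𝓝 0) := by
    have h1 : Tendsto (fun j => ‖x (φ j) - q‖) atTop (𝓝 0) := by
      have := tendsto_iff_norm_sub_tendsto_zero.1 hlim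
      exact this
    have h2 : Tendsto (fun j => (Mu * ‖x (φ j) - q‖) ^ 2) atTop (𝓝 0) := by
      have := (h1.const_mul Mu).pow 2
      simpa using this
    refine squeeze_zero (fun j => sq_nonneg _) (fun j => ?_) h2
    exact pow_le_pow_left₀ ((hN _).nonneg _) ((hN (φ j)).upper _) 2
  have ha0 : Tendsto a atTop (𝓝 0) :=
    tendsto_zero_of_le_mul_add (fun k => sq_nonneg _) hη (fun _ => le_rfl) hηs summable_zero hrec
      hφ hsub
  refine ⟨q, hq, ?_⟩
  rw [tendsto_iff_norm_sub_tendsto_zero]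
  have hsq : Tendsto (fun k => N k (x k - q)) atTop (𝓝 0) := by
    have := ha0.sqrt
    simpa [ha, Real.sqrt_sq ((hN _).nonneg _)] using this
  refine squeeze_zero (fun k => norm_nonneg _) (fun k => (hN k).norm_le _) ?_
  have := hsq.div_const m
  rwa [zero_div] at this

/-- **[EB92, THEOREM 3] with exact resolvents, in the geometry of an equivalent Euclidean gauge, on a
proper space.** Let `N` be an equivalent Euclidean gauge (e.g. `‖·‖_M`, `M ≻ 0`), `f` continuous and
FIRMLY quasi-nonexpansive in `N` towards its nonempty fixed-point set (`N(fz − y)² + N(z − fz)² ≤ N(z − y)²`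
— a resolvent `(I + cT)⁻¹` [EB92, Thm 2], a proximal-point step in the metric of `N`), and
`ρ_k ∈ [ρlo, ρhi]` with `0 < ρlo`, `ρhi < 2` ("`inf ρ_k > 0`, `sup ρ_k < 2`"). Then the generalized
proximal point iteration `z^{k+1} = (1 − ρ_k) z^k + ρ_k f(z^k)` converges to a fixed point of `f` (a zero
of `T`): "if `T` possesses any zero, `{z^k}` converges … to a zero of `T`".
[cite: EcksteinBertsekas1992, §3 Thm 3 (ε_k = 0, c_k ≡ c)] -/
theorem exists_tendsto_relaxed_of_firm [ProperSpace E] {N : E → ℝ} (hN : IsEuclideanGauge N m Mu)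
    {f : E → E} (hf : Continuous f)
    (hfirm : ∀ y ∈ Function.fixedPoints f, ∀ z, N (f z - y) ^ 2 + N (z - f z) ^ 2 ≤ N (z - y) ^ 2)
    (hne : (Function.fixedPoints f).Nonempty) (hρlo : 0 < ρlo) (hρhi : ρhi < 2)
    (hρ : ∀ k, ρlo ≤ ρ k ∧ ρ k ≤ ρhi) (hx : ∀ k, x (k + 1) = x k + ρ k • (f (x k) - x k)) :
    ∃ q ∈ Function.fixedPoints f, Tendsto x atTop (𝓝 q) := by
  refine exists_tendsto_of_firm_varGauge (N := fun _ => N) (η := fun _ => 0) (f := fun _ => f)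
    (fun _ => hN) (fun _ => le_rfl) summable_zero (fun k d => by simp) hne
    (fun k y hy z => hfirm y hy z) hρlo hρhi hρ hx ?_
  intro q φ hφ hlim hres
  have h1 : Tendsto (fun j => f (x (φ j)) - x (φ j)) atTop (𝓝 (f q - q)) :=
    ((hf.sub continuous_id).tendsto q).comp hlim
  have h2 : f q - q = 0 := tendsto_nhds_unique h1 hres
  exact Function.mem_fixedPoints.2 (sub_eq_zero.1 h2)

end Engine

/-! ## §3 Over-relaxed PDHG with fixed steps `(τ, σ)` ([CP16, Algorithm 2]; convergence = [EB92, Thm 3]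
∘ [CP16, §3 (12)]) -/

section PDHG

open Literature.Analysis.Convex.MonotoneOperator (IsMonotone IsResolventMap zer)
open Literature.Analysis.Convex.PrimalDualHybridGradient
open Literature.Analysis.Convex.RestartedPDHG
open Literature.Analysis.Convex.AndersonAccelerationPDHG (isEuclideanGauge_normM normM_pdhgStep_firm
  qM_convex_combination)
open Literature.Analysis.Convex.DouglasRachford (normalCone isMonotone_normalCone isResolventMap_proj)
open Literature.Analysis.Convex.ConvexMetricProjection (proj)

variable {X Y : Type*} [NormedAddCommGroup X] [InnerProductSpace ℝ X] [CompleteSpace X]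
  [NormedAddCommGroup Y] [InnerProductSpace ℝ Y] [CompleteSpace Y]

/-- **The over-relaxed PDHG iteration** ([CP16, Algorithm 2, (22)] with `θ = 1`, `L_f = 0`):
`ζ^{n+1} = PD_{τ,σ}(z^n)` (one PDHG step `pdhgStep`), `z^{n+1} = (1 − ρ_n) z^n + ρ_n ζ^{n+1}
= z^n + ρ_n (ζ^{n+1} − z^n)`. [cite: ChambollePock2015, §4.1 Algorithm 2 (22)]
[cite: EcksteinBertsekas1992, §3 Thm 3 (generalized proximal point algorithm)] -/
noncomputable def relaxedPdhgIter (K : X →L[ℝ] Y) (τ σ : ℝ) (ρ : ℕ → ℝ) (jA : X → X) (jB : Y → Y)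
    (z₀ : X × Y) : ℕ → X × Y
  | 0 => z₀
  | n + 1 => relaxedPdhgIter K τ σ ρ jA jB z₀ n +
      ρ n • (pdhgStep K τ σ jA jB (relaxedPdhgIter K τ σ ρ jA jB z₀ n) -
        relaxedPdhgIter K τ σ ρ jA jB z₀ n)

omit [CompleteSpace X] [CompleteSpace Y] in
/-- The recursion of `relaxedPdhgIter`. [cite: ChambollePock2015, §4.1 Algorithm 2 (22)] -/
theorem relaxedPdhgIter_succ [CompleteSpace X] [CompleteSpace Y] (K : X →L[ℝ] Y) (τ σ : ℝ)
    (ρ : ℕ → ℝ) (jA : X → X) (jB : Y → Y) (z₀ : X × Y) (n : ℕ) :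
    relaxedPdhgIter K τ σ ρ jA jB z₀ (n + 1) = relaxedPdhgIter K τ σ ρ jA jB z₀ n +
      ρ n • (pdhgStep K τ σ jA jB (relaxedPdhgIter K τ σ ρ jA jB z₀ n) -
        relaxedPdhgIter K τ σ ρ jA jB z₀ n) := rfl

/-- With `ρ_n ≡ 1` the over-relaxed iteration is plain PDHG (`pdhgIter`).
[cite: ChambollePock2015, §4.1 (ρ_n = 1 is Algorithm 1)] -/
theorem relaxedPdhgIter_one [FiniteDimensional ℝ X] [FiniteDimensional ℝ Y] (K : X →L[ℝ] Y)
    (τ σ : ℝ) (jA : X → X) (jB : Y → Y) (z₀ : X × Y) (n : ℕ) :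
    relaxedPdhgIter K τ σ (fun _ => 1) jA jB z₀ n = pdhgIter K τ σ jA jB z₀ n := by
  induction n with
  | zero => rfl
  | succ n ih =>
    rw [relaxedPdhgIter_succ, ih, one_smul, add_sub_cancel]
    rfl

/-- `‖u − v‖²_M = ‖v − u‖²_M`. [cite: ChambollePock2015, §3 (12)] -/
theorem qM_sub_rev (K : X →L[ℝ] Y) (τ σ : ℝ) (u v : X × Y) :
    qM K τ σ (u - v) = qM K τ σ (v - u) := by
  have h : u - v = (-1 : ℝ) • (v - u) := by module
  rw [h, qM_smul]; ring

/-- **The relaxed Fejér inequality for PDHG in `M_{τ,σ}`** (`τσ‖K‖² ≤ 1`, `0 ≤ ρ`): for a saddle point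
`z*` and `z⁺ = z + ρ(PD(z) − z)`,
`‖z⁺ − z*‖²_M ≤ ‖z − z*‖²_M − ρ(2−ρ) ‖PD(z) − z‖²_M` (from the tree's firm inequality `fejer_step` /
`normM_pdhgStep_firm` and the parallelogram identity of `‖·‖²_M`).
[cite: ChambollePock2015, §4.1 Thm 2 (proof, the −(2−ρ_n)/(2ρ_n²)‖z^{n+1} − z^n‖² term)]
[cite: EcksteinBertsekas1992, §3 Thm 3 (proof)] -/
theorem qM_relaxStep_le (K : X →L[ℝ] Y) {A : Set (X × X)} {B : Set (Y × Y)} {τ σ : ℝ}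
    (hτ : 0 < τ) (hσ : 0 < σ) (hK : τ * σ * ‖K‖ ^ 2 ≤ 1) (hA : IsMonotone A) (hB : IsMonotone B)
    {jA : X → X} {jB : Y → Y} (hjA : IsResolventMap τ A jA) (hjB : IsResolventMap σ B jB)
    {zs : X × Y} (hzs : WithLp.toLp 2 zs ∈ zer (kkt K A B)) {ρ : ℝ} (hρ0 : 0 ≤ ρ) (u : X × Y) :
    qM K τ σ ((u + ρ • (pdhgStep K τ σ jA jB u - u)) - zs) ≤
      qM K τ σ (u - zs) - ρ * (2 - ρ) * qM K τ σ (pdhgStep K τ σ jA jB u - u) := by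
  have hfirm := normM_pdhgStep_firm K hτ hσ hK hA hB hjA hjB hzs u
  rw [normM_sq K hτ hσ hK, normM_sq K hτ hσ hK, normM_sq K hτ hσ hK,
    qM_sub_rev K τ σ u (pdhgStep K τ σ jA jB u)] at hfirm
  have h1 : (u + ρ • (pdhgStep K τ σ jA jB u - u)) - zs =
      (1 - ρ) • (u - zs) + ρ • (pdhgStep K τ σ jA jB u - zs) := by module
  have h2 : (u - zs) - (pdhgStep K τ σ jA jB u - zs) = u - pdhgStep K τ σ jA jB u := by abel
  rw [h1, qM_convex_combination, h2, qM_sub_rev K τ σ u (pdhgStep K τ σ jA jB u)]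
  have h4 : ρ * qM K τ σ (pdhgStep K τ σ jA jB u - zs) ≤
      ρ * (qM K τ σ (u - zs) - qM K τ σ (pdhgStep K τ σ jA jB u - u)) :=
    mul_le_mul_of_nonneg_left (by linarith) hρ0
  nlinarith [h4]

/-- **The summed residual bound of over-relaxed PDHG**: for `τσ‖K‖² ≤ 1`, `0 ≤ ρ_k ≤ 2`, a saddle point
`z*` and every `K₀`, `Σ_{k<K₀} ρ_k(2−ρ_k) ‖PD(z^k) − z^k‖²_M ≤ ‖z⁰ − z*‖²_M` (telescoping the relaxed
Fejér inequality; the printed proofs drop these nonpositive terms).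
[cite: ChambollePock2015, §4.1 Thm 2 (proof: "omitting all nonpositive terms")]
[cite: EcksteinBertsekas1992, §3 Thm 3 (proof)] -/
theorem sum_relaxed_residual_le (K : X →L[ℝ] Y) {A : Set (X × X)} {B : Set (Y × Y)} {τ σ : ℝ}
    (hτ : 0 < τ) (hσ : 0 < σ) (hK : τ * σ * ‖K‖ ^ 2 ≤ 1) (hA : IsMonotone A) (hB : IsMonotone B)
    {jA : X → X} {jB : Y → Y} (hjA : IsResolventMap τ A jA) (hjB : IsResolventMap σ B jB)
    {zs : X × Y} (hzs : WithLp.toLp 2 zs ∈ zer (kkt K A B)) {ρ : ℕ → ℝ}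
    (hρ : ∀ k, 0 ≤ ρ k ∧ ρ k ≤ 2) (z₀ : X × Y) (K₀ : ℕ) :
    ∑ k ∈ Finset.range K₀, ρ k * (2 - ρ k) *
        qM K τ σ (pdhgStep K τ σ jA jB (relaxedPdhgIter K τ σ ρ jA jB z₀ k) -
          relaxedPdhgIter K τ σ ρ jA jB z₀ k) ≤ qM K τ σ (z₀ - zs) := by
  set z := relaxedPdhgIter K τ σ ρ jA jB z₀ with hz
  have hstep : ∀ k, qM K τ σ (z (k + 1) - zs) ≤
      qM K τ σ (z k - zs) - ρ k * (2 - ρ k) * qM K τ σ (pdhgStep K τ σ jA jB (z k) - z k) :=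
    fun k => by
    rw [hz, relaxedPdhgIter_succ]
    exact qM_relaxStep_le K hτ hσ hK hA hB hjA hjB hzs (hρ k).1 _
  have htel : ∀ K₀, ∑ k ∈ Finset.range K₀, ρ k * (2 - ρ k) *
      qM K τ σ (pdhgStep K τ σ jA jB (z k) - z k) ≤ qM K τ σ (z 0 - zs) - qM K τ σ (z K₀ - zs) := by
    intro K₀
    induction K₀ with
    | zero => simp
    | succ K₀ ih =>
      rw [Finset.sum_range_succ]
      linarith [hstep K₀]
  have h0 : z 0 = z₀ := rfl
  have hnn : 0 ≤ qM K τ σ (z K₀ - zs) := qM_nonneg K hτ hσ hK _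
  have h := htel K₀
  rw [h0] at h
  linarith

/-- **Over-relaxed PDHG converges to a saddle point** ([CP16, Alg. 2]: "whose convergence has been
considered already in [14, 16]" = [EB92, Thm 3] for the proximal-point form [HeYuan2012] of PDHG in
`M_{τ,σ}`). Finite-dimensional `X`, `Y`; `A ⊂ X × X`, `B ⊂ Y × Y` monotone with resolvent maps
`jA = J_{τA}`, `jB = J_{σB}`; FIXED `τ, σ > 0` with `τσ‖K‖² < 1`; a saddle point exists; relaxation
factors `ρ_k ∈ [ρlo, ρhi]`, `0 < ρlo`, `ρhi < 2`. Then `z^k → z*` with `z* ∈ zer F` a saddle point.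
[cite: EcksteinBertsekas1992, §3 Thm 3] [cite: ChambollePock2015, §4.1 Algorithm 2 and §3 (12)]
[cite: HeYuan2012, §2 (PPA interpretation)] -/
theorem tendsto_relaxedPdhgIter [FiniteDimensional ℝ X] [FiniteDimensional ℝ Y] (K : X →L[ℝ] Y)
    {A : Set (X × X)} {B : Set (Y × Y)} {τ σ : ℝ} (hτ : 0 < τ) (hσ : 0 < σ)
    (hK : τ * σ * ‖K‖ ^ 2 < 1) (hA : IsMonotone A) (hB : IsMonotone B) {jA : X → X} {jB : Y → Y}
    (hjA : IsResolventMap τ A jA) (hjB : IsResolventMap σ B jB) (hsad : (zer (kkt K A B)).Nonempty)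
    {ρ : ℕ → ℝ} {ρlo ρhi : ℝ} (hρlo : 0 < ρlo) (hρhi : ρhi < 2) (hρ : ∀ k, ρlo ≤ ρ k ∧ ρ k ≤ ρhi)
    (z₀ : X × Y) :
    ∃ zs : X × Y, WithLp.toLp 2 zs ∈ zer (kkt K A B) ∧
      Tendsto (relaxedPdhgIter K τ σ ρ jA jB z₀) atTop (𝓝 zs) := by
  have hN := isEuclideanGauge_normM K hτ hσ hK
  have hfix : ∀ u : X × Y, u ∈ Function.fixedPoints (pdhgStep K τ σ jA jB) ↔
      WithLp.toLp 2 u ∈ zer (kkt K A B) := fun u =>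
    (pdhgStep_eq_self_iff K hτ hσ hA hB hjA hjB u)
  obtain ⟨ps, hps⟩ := hsad
  have hne : (Function.fixedPoints (pdhgStep K τ σ jA jB)).Nonempty :=
    ⟨WithLp.ofLp ps, (hfix _).2 (by simpa using hps)⟩
  have hfirm : ∀ y ∈ Function.fixedPoints (pdhgStep K τ σ jA jB), ∀ u,
      normM K τ σ (pdhgStep K τ σ jA jB u - y) ^ 2 +
          normM K τ σ (u - pdhgStep K τ σ jA jB u) ^ 2 ≤ normM K τ σ (u - y) ^ 2 := fun y hy u =>
    normM_pdhgStep_firm K hτ hσ hK.le hA hB hjA hjB ((hfix y).1 hy) u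
  obtain ⟨zs, hzs, hlim⟩ := exists_tendsto_relaxed_of_firm (x := relaxedPdhgIter K τ σ ρ jA jB z₀)
    hN (continuous_pdhgStep K hτ hσ hA hB hjA hjB) hfirm hne hρlo hρhi hρ (fun k => rfl)
  exact ⟨zs, (hfix zs).1 hzs, hlim⟩

/-- **The conic / projection form** (the kernel of PDLP-type cone-program solvers, run with a relaxation
factor): nonempty closed convex `C ⊆ X`, `D ⊆ Y`, costs `c`, `b`, resolvent maps `x ↦ P_C(x − τc)`,
`y ↦ P_D(y − σb)`, FIXED `τσ‖K‖² < 1`, a saddle point of `⟨c,x⟩ + ⟨Kx,y⟩ − ⟨b,y⟩` on `C × D` exists,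
`ρ_k ∈ [ρlo, ρhi] ⊂ (0, 2)`: the over-relaxed PDHG iterates converge to a saddle point.
[cite: EcksteinBertsekas1992, §3 Thm 3] [cite: ChambollePock2015, §4.1 Algorithm 2]
[cite: ChambollePock2010, Theorem 1 (c)] -/
theorem tendsto_relaxedPdhgIter_conic [FiniteDimensional ℝ X] [FiniteDimensional ℝ Y]
    (K : X →L[ℝ] Y) {C : Set X} {D : Set Y} (hCne : C.Nonempty) (hCcl : IsClosed C)
    (hCc : Convex ℝ C) (hDne : D.Nonempty) (hDcl : IsClosed D) (hDc : Convex ℝ D) (c : X) (b : Y)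
    {τ σ : ℝ} (hτ : 0 < τ) (hσ : 0 < σ) (hK : τ * σ * ‖K‖ ^ 2 < 1)
    (hsad : (zer (kkt K (shiftOp c (normalCone C)) (shiftOp b (normalCone D)))).Nonempty)
    {ρ : ℕ → ℝ} {ρlo ρhi : ℝ} (hρlo : 0 < ρlo) (hρhi : ρhi < 2) (hρ : ∀ k, ρlo ≤ ρ k ∧ ρ k ≤ ρhi)
    (z₀ : X × Y) :
    ∃ zs : X × Y, WithLp.toLp 2 zs ∈ zer (kkt K (shiftOp c (normalCone C)) (shiftOp b (normalCone D)))
      ∧ Tendsto (relaxedPdhgIter K τ σ ρ (fun x => proj C (x - τ • c)) (fun y => proj D (y - σ • b)) z₀)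
          atTop (𝓝 zs) :=
  tendsto_relaxedPdhgIter K hτ hσ hK (isMonotone_shiftOp c (isMonotone_normalCone C))
    (isMonotone_shiftOp b (isMonotone_normalCone D))
    (isResolventMap_shiftOp (isResolventMap_proj hCne hCcl.isComplete hCc hτ))
    (isResolventMap_shiftOp (isResolventMap_proj hDne hDcl.isComplete hDc hσ)) hsad hρlo hρhi hρ z₀

/-! ## §4 The `O(1/(ρN))` ergodic rate of over-relaxed PDHG ([CP16, THEOREM 2], `L_f = 0`) -/

/-- The PD points of the over-relaxed scheme: `ζ^{n+1} = PD_{τ,σ}(z^n)` (the value at `0` is a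
placeholder; the averages below use `ζ^1, …, ζ^N`). [cite: ChambollePock2015, §4.1 Algorithm 2 (22) (ζ^n = (ξ^n, η^n))] -/
noncomputable def relaxedPdhgPoint (K : X →L[ℝ] Y) (τ σ : ℝ) (ρ : ℕ → ℝ) (jA : X → X) (jB : Y → Y)
    (z₀ : X × Y) : ℕ → X × Y
  | 0 => z₀
  | n + 1 => pdhgStep K τ σ jA jB (relaxedPdhgIter K τ σ ρ jA jB z₀ n)

/-- **The per-step inequality of the printed proof** (times `ρ_n`): for `(ξ, η) ∈ C × D`, `0 ≤ ρ_n`,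
`ρ_n · (L(ξ^{n+1}, η) − L(ξ, η^{n+1})) ≤ ½ (‖z^n − (ξ,η)‖²_M − ‖z^{n+1} − (ξ,η)‖²_M)
 − ½ ρ_n(2−ρ_n) ‖ζ^{n+1} − z^n‖²_M` — obtained from the tree's one-step inequality `conicL_step_le` at
`ζ^{n+1} = PD(z^n)` by substituting `ζ^{n+1} = z^n + ρ_n⁻¹(z^{n+1} − z^n)`.
[cite: ChambollePock2015, §4.1 Thm 2 (proof, display before "where we have defined the metric")] -/
theorem conicL_relaxed_step_le (K : X →L[ℝ] Y) {C : Set X} {D : Set Y} (c : X) (b : Y) {τ σ : ℝ}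
    (hτ : 0 < τ) (hσ : 0 < σ) {jA : X → X} {jB : Y → Y}
    (hjA : IsResolventMap τ (shiftOp c (normalCone C)) jA)
    (hjB : IsResolventMap σ (shiftOp b (normalCone D)) jB) {ρ : ℝ} (hρ0 : 0 ≤ ρ) (u : X × Y)
    {ξ : X} (hξ : ξ ∈ C) {η : Y} (hη : η ∈ D) :
    ρ * (conicL K c b (pdhgStep K τ σ jA jB u).1 η - conicL K c b ξ (pdhgStep K τ σ jA jB u).2) ≤
      2⁻¹ * (qM K τ σ (u - (ξ, η)) - qM K τ σ ((u + ρ • (pdhgStep K τ σ jA jB u - u)) - (ξ, η))) -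
        2⁻¹ * (ρ * (2 - ρ)) * qM K τ σ (pdhgStep K τ σ jA jB u - u) := by
  have hgap := conicL_step_le K c b hτ hσ hjA hjB u hξ hη
  set T := pdhgStep K τ σ jA jB u with hT
  -- rewrite the right-hand side of `hgap` with `qM`
  have hgap' : conicL K c b T.1 η - conicL K c b ξ T.2 ≤
      2⁻¹ * (qM K τ σ (u - (ξ, η)) - qM K τ σ (T - (ξ, η)) - qM K τ σ (u - T)) := by
    simpa [qM_eq, WithLp.toLp_sub] using hgap
  -- `d = u − (ξ,η)`, `e = T − u`
  have e1 : T - (ξ, η) = (u - (ξ, η)) + (T - u) := by abel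
  have e2 : (u + ρ • (T - u)) - (ξ, η) = (u - (ξ, η)) + ρ • (T - u) := by abel
  rw [e2, qM_add_smul]
  rw [e1, qM_add, qM_sub_rev K τ σ u T] at hgap'
  have h := mul_le_mul_of_nonneg_left hgap' hρ0
  nlinarith [h]

/-- **[CP16, THEOREM 2] (ergodic `O(1/(ρ₀N))` rate of over-relaxed PDHG), constrained bilinear case
`L_f = 0`.** For the conic saddle `L(x,y) = ⟨c,x⟩ + ⟨Kx,y⟩ − ⟨b,y⟩` on `C × D` (resolvent maps of
`c + N_C`, `b + N_D`), step sizes `τ, σ > 0` with `τσ‖K‖² ≤ 1`, and relaxation factors `ρ_n`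
NON-DECREASING with `0 < ρ_n ≤ 2`: for every `(x, y) ∈ C × D` and `N ≥ 1`,
`L(X_N, y) − L(x, Y_N) ≤ ‖z⁰ − (x,y)‖²_{M_{τ,σ}} / (2ρ₀N)`, where `X_N = N⁻¹ Σ_{n=1}^N ξ^n`,
`Y_N = N⁻¹ Σ_{n=1}^N η^n` are the averages of the PD points `ζ^n = (ξ^n, η^n)`. ("the convergence rate is
improved by choosing `ρ₀` as large as possible, i.e. close to 2", Remark 6.) Printed with
`ρ_n ∈ (0, ρ̄)`, `ρ̄ < 2` and the strict (23); for `L_f = 0` the proof uses only `M_{τ,σ} ⪰ 0`.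
[cite: ChambollePock2015, §4.1 Theorem 2 ((23)–(24)) and Remark 6] -/
theorem conicL_gap_ergodic_relaxed_le (K : X →L[ℝ] Y) {C : Set X} {D : Set Y} (c : X) (b : Y)
    {τ σ : ℝ} (hτ : 0 < τ) (hσ : 0 < σ) (hK : τ * σ * ‖K‖ ^ 2 ≤ 1) {jA : X → X} {jB : Y → Y}
    (hjA : IsResolventMap τ (shiftOp c (normalCone C)) jA)
    (hjB : IsResolventMap σ (shiftOp b (normalCone D)) jB) {ρ : ℕ → ℝ} (hρ0 : ∀ n, 0 < ρ n)
    (hρ2 : ∀ n, ρ n ≤ 2) (hρm : Monotone ρ) (z₀ : X × Y) {ξ : X} (hξ : ξ ∈ C) {η : Y} (hη : η ∈ D)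
    {N : ℕ} (hN : N ≠ 0) :
    conicL K c b (xAvg (relaxedPdhgPoint K τ σ ρ jA jB z₀) N) η -
        conicL K c b ξ (yAvg (relaxedPdhgPoint K τ σ ρ jA jB z₀) N) ≤
      qM K τ σ (z₀ - (ξ, η)) / (2 * ρ 0 * N) := by
  set z := relaxedPdhgIter K τ σ ρ jA jB z₀ with hz
  set ζ := relaxedPdhgPoint K τ σ ρ jA jB z₀ with hζ
  have hζsucc : ∀ n, ζ (n + 1) = pdhgStep K τ σ jA jB (z n) := fun n => rfl
  set Dn : ℕ → ℝ := fun n => qM K τ σ (z n - (ξ, η)) with hDn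
  set gap : ℕ → ℝ := fun n => conicL K c b (ζ (n + 1)).1 η - conicL K c b ξ (ζ (n + 1)).2 with hgap
  have hDnn : ∀ n, 0 ≤ Dn n := fun n => qM_nonneg K hτ hσ hK _
  -- per-step: `gap n ≤ (Dn n − Dn (n+1)) / (2 ρ n)`
  have hstep : ∀ n, gap n ≤ (Dn n - Dn (n + 1)) / (2 * ρ n) := fun n => by
    have h := conicL_relaxed_step_le K c b hτ hσ hjA hjB (hρ0 n).le (z n) hξ hη
    have hsucc : z (n + 1) = z n + ρ n • (pdhgStep K τ σ jA jB (z n) - z n) := by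
      rw [hz, relaxedPdhgIter_succ]
    rw [← hsucc] at h
    have hnn : 0 ≤ 2⁻¹ * (ρ n * (2 - ρ n)) * qM K τ σ (pdhgStep K τ σ jA jB (z n) - z n) :=
      mul_nonneg (mul_nonneg (by norm_num) (mul_nonneg (hρ0 n).le (by linarith [hρ2 n])))
        (qM_nonneg K hτ hσ hK _)
    rw [le_div_iff₀ (by linarith [hρ0 n])]
    simp only [hgap, hDn, hζsucc]
    linarith
  -- telescoping with non-decreasing `ρ`
  have htel : ∀ N, ∑ n ∈ Finset.range N, gap n + Dn N / (2 * ρ N) ≤ Dn 0 / (2 * ρ 0) := by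
    intro N
    induction N with
    | zero => simp
    | succ N ih =>
      rw [Finset.sum_range_succ]
      have h1 := hstep N
      have h2 : Dn (N + 1) / (2 * ρ (N + 1)) ≤ Dn (N + 1) / (2 * ρ N) :=
        div_le_div_of_nonneg_left (hDnn _) (by linarith [hρ0 N])
          (by linarith [hρm (Nat.le_succ N)])
      have h3 : (Dn N - Dn (N + 1)) / (2 * ρ N) = Dn N / (2 * ρ N) - Dn (N + 1) / (2 * ρ N) := by
        rw [sub_div]
      linarith
  have hsum : ∑ n ∈ Finset.range N, gap n ≤ Dn 0 / (2 * ρ 0) := by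
    have h := htel N
    have h2 : 0 ≤ Dn N / (2 * ρ N) := div_nonneg (hDnn N) (by linarith [hρ0 N])
    linarith
  -- averages
  have hN' : (0 : ℝ) < N := Nat.cast_pos.mpr (Nat.pos_of_ne_zero hN)
  rw [conicL_xAvg K c b ζ hN η, conicL_yAvg K c b ζ hN ξ, ← mul_sub, ← Finset.sum_sub_distrib]
  have hz0 : Dn 0 = qM K τ σ (z₀ - (ξ, η)) := by simp [hDn, hz, relaxedPdhgIter]
  rw [← hz0]
  calc (N : ℝ)⁻¹ * ∑ n ∈ Finset.range N, gap n ≤ (N : ℝ)⁻¹ * (Dn 0 / (2 * ρ 0)) :=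
        mul_le_mul_of_nonneg_left hsum (inv_nonneg.mpr hN'.le)
    _ = Dn 0 / (2 * ρ 0 * N) := by
        field_simp

end PDHG

/-! ## §5 Variable step sizes `(τ_k, σ_k)` — adaptive steps / primal-weight schedules
([GLYEB, Thm 1] under conditions (A), (B), (C1); relaxation factors allowed) -/

section VariableSteps

open Literature.Analysis.Convex.MonotoneOperator (IsMonotone IsResolventMap zer)
open Literature.Analysis.Convex.PrimalDualHybridGradient
open Literature.Analysis.Convex.RestartedPDHG
open Literature.Analysis.Convex.AndersonAccelerationPDHG (isEuclideanGauge_normM normM_pdhgStep_firm)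
open Literature.Analysis.Convex.DouglasRachford (normalCone isMonotone_normalCone isResolventMap_proj)
open Literature.Analysis.Convex.ConvexMetricProjection (proj)

/-- A monotone operator that admits a (continuous) resolvent map `j = (I + cT)⁻¹`, `c > 0`, has CLOSED
graph: `T = {(x, y) | j(x + cy) = x}` ("if `(y, a) ∈ A` then `J_{λA}(y + λa) = y`", and conversely
`(jz, c⁻¹(z − jz)) ∈ T`). (Maximal monotone operators have closed graphs; this is the form available
from a resolvent map.) [cite: EcksteinBertsekas1992, §2 Thm 2, Cor 2.2–2.3 and §4 p. 303] -/
theorem isClosed_of_isResolventMap {H : Type*} [NormedAddCommGroup H] [InnerProductSpace ℝ H]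
    {c : ℝ} {T : Set (H × H)} {j : H → H} (hj : IsResolventMap c T j) (hT : IsMonotone T)
    (hc : 0 < c) : IsClosed T := by
  have heq : T = {p : H × H | j (p.1 + c • p.2) = p.1} := by
    ext ⟨x, y⟩
    constructor
    · intro h; exact hj.apply_add_smul hT hc h
    · intro h
      have hm := hj.mem hc.ne' (x + c • y)
      have hx : j (x + c • y) = x := h
      rw [hx] at hm
      have : c⁻¹ • (x + c • y - x) = y := by
        rw [add_sub_cancel_left, smul_smul, inv_mul_cancel₀ hc.ne', one_smul]
      rwa [this] at hm
  rw [heq]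
  exact isClosed_eq ((hj.continuous hT hc).comp (continuous_fst.add (continuous_snd.const_smul c)))
    continuous_fst

variable {X Y : Type*} [NormedAddCommGroup X] [InnerProductSpace ℝ X] [CompleteSpace X]
  [NormedAddCommGroup Y] [InnerProductSpace ℝ Y] [CompleteSpace Y]

/-- **Limits of approximate KKT pairs are saddle points** (closed graphs): if `(u_j¹, a_j) ∈ A`,
`(u_j², b_j) ∈ B` with `u_j → ū`, `a_j → −K* ū²`, `b_j → K ū¹`, and `A`, `B` have closed graphs, then
`ū ∈ zer F` (`−K* ȳ ∈ A x̄`, `K x̄ ∈ B ȳ`). This is the step "`R_k → 0` ⇒ limit points are solutions".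
[cite: GoldsteinEtAl2013, §6.7 Thm 1 (R_k ∈ R(u_{k+1}), ‖R_k‖ → 0)] [cite: ChambollePock2010, Theorem 1 (c) (proof)] -/
theorem mem_zer_kkt_of_tendsto (K : X →L[ℝ] Y) {A : Set (X × X)} {B : Set (Y × Y)} (hAc : IsClosed A)
    (hBc : IsClosed B) {u : ℕ → X × Y} {a : ℕ → X} {b : ℕ → Y} {ul : X × Y}
    (hA : ∀ j, ((u j).1, a j) ∈ A) (hB : ∀ j, ((u j).2, b j) ∈ B) (hu : Tendsto u atTop (𝓝 ul))
    (ha : Tendsto a atTop (𝓝 (-K.adjoint ul.2))) (hb : Tendsto b atTop (𝓝 (K ul.1))) :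
    WithLp.toLp 2 ul ∈ zer (kkt K A B) := by
  rw [mem_zer_kkt_iff]
  have hu1 : Tendsto (fun j => (u j).1) atTop (𝓝 ul.1) := (continuous_fst.tendsto ul).comp hu
  have hu2 : Tendsto (fun j => (u j).2) atTop (𝓝 ul.2) := (continuous_snd.tendsto ul).comp hu
  exact ⟨hAc.mem_of_tendsto (hu1.prodMk_nhds ha) (Eventually.of_forall hA),
    hBc.mem_of_tendsto (hu2.prodMk_nhds hb) (Eventually.of_forall hB)⟩

/-- **The relative step decrease** `φ_k = max{(τ_k − τ_{k+1})/τ_k, (σ_k − σ_{k+1})/σ_k, 0}` of the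
printed condition (B) ("`φ` quantifies the relative decrease in the stepsizes between iterations").
[cite: GoldsteinEtAl2013, §6.2 (definition of δ_k, φ_k)] -/
noncomputable def stepDecrease (τ σ : ℕ → ℝ) (k : ℕ) : ℝ :=
  max (max ((τ k - τ (k + 1)) / τ k) ((σ k - σ (k + 1)) / σ k)) 0

/-- `φ_k ≥ 0`. [cite: GoldsteinEtAl2013, §6.2 (φ_k = 1 − δ_k, δ_k ≤ 1)] -/
theorem stepDecrease_nonneg (τ σ : ℕ → ℝ) (k : ℕ) : 0 ≤ stepDecrease τ σ k := le_max_right _ _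

/-- `τ_{k+1} ≥ (1 − φ_k) τ_k`. [cite: GoldsteinEtAl2013, §6.2 (δ_k ≤ τ_{k+1}/τ_k)] -/
theorem one_sub_stepDecrease_mul_le_tau {τ σ : ℕ → ℝ} {k : ℕ} (hτ : 0 < τ k) :
    (1 - stepDecrease τ σ k) * τ k ≤ τ (k + 1) := by
  have h : (τ k - τ (k + 1)) / τ k ≤ stepDecrease τ σ k :=
    (le_max_left _ _).trans (le_max_left _ _)
  rw [div_le_iff₀ hτ] at h
  nlinarith

/-- `σ_{k+1} ≥ (1 − φ_k) σ_k`. [cite: GoldsteinEtAl2013, §6.2 (δ_k ≤ σ_{k+1}/σ_k)] -/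
theorem one_sub_stepDecrease_mul_le_sigma {τ σ : ℕ → ℝ} {k : ℕ} (hσ : 0 < σ k) :
    (1 - stepDecrease τ σ k) * σ k ≤ σ (k + 1) := by
  have h : (σ k - σ (k + 1)) / σ k ≤ stepDecrease τ σ k :=
    (le_max_right _ _).trans (le_max_left _ _)
  rw [div_le_iff₀ hσ] at h
  nlinarith

/-- **How `‖·‖²_{M_{τ,σ}}` depends on the steps**: the coupling term `−2⟨K d_x, d_y⟩` is step-independent,
so `‖d‖²_{M_{τ',σ'}} − ‖d‖²_{M_{τ,σ}} = (1/τ' − 1/τ)‖d_x‖² + (1/σ' − 1/σ)‖d_y‖²`.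
[cite: GoldsteinEtAl2013, §6.6 Lemma 1 (proof: uᵀMu = ‖x‖²/τ − 2yᵀAx + ‖y‖²/σ)] [cite: ChambollePock2015, §3 (12)] -/
theorem qM_sub_qM (K : X →L[ℝ] Y) (τ σ τ' σ' : ℝ) (d : X × Y) :
    qM K τ' σ' d - qM K τ σ d = (τ'⁻¹ - τ⁻¹) * ‖d.1‖ ^ 2 + (σ'⁻¹ - σ⁻¹) * ‖d.2‖ ^ 2 := by
  rw [qM_eq, qM_eq, inner_metricM_self, inner_metricM_self]
  simp only [WithLp.toLp_fst, WithLp.toLp_snd]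
  ring

/-- **The metrics of consecutive steps are comparable through `φ_k`** (the role of condition (B)): if
`τ' ≥ (1−φ)τ`, `σ' ≥ (1−φ)σ` with `0 ≤ φ ≤ ½`, and `τσ‖K‖² < 1`, then
`‖d‖²_{M_{τ',σ'}} ≤ (1 + 2φ / (1 − √(τσ)‖K‖)) · ‖d‖²_{M_{τ,σ}}` (the increase `1/τ' − 1/τ ≤ 2φ/τ` is
absorbed by the coercivity `(1 − √(τσ)‖K‖)(‖d_x‖²/τ + ‖d_y‖²/σ) ≤ ‖d‖²_M` of [GLYEB, Lemma 1]).
[cite: GoldsteinEtAl2013, §6.6 Lemma 1 and §6.7 Thm 1 (proof: "the various M_k-norms do not differ too much")] -/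
theorem qM_succ_le (K : X →L[ℝ] Y) {τ σ τ' σ' : ℝ} (hτ : 0 < τ) (hσ : 0 < σ)
    (hK : τ * σ * ‖K‖ ^ 2 < 1) {φ : ℝ} (hφ0 : 0 ≤ φ) (hφ : φ ≤ 2⁻¹) (hτ' : (1 - φ) * τ ≤ τ')
    (hσ' : (1 - φ) * σ ≤ σ') (d : X × Y) :
    qM K τ' σ' d ≤ (1 + 2 * φ / (1 - Real.sqrt (τ * σ) * ‖K‖)) * qM K τ σ d := by
  set γ : ℝ := 1 - Real.sqrt (τ * σ) * ‖K‖ with hγ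
  have hγpos : 0 < γ := by
    have h0 : 0 ≤ Real.sqrt (τ * σ) * ‖K‖ := by positivity
    have h1 : (Real.sqrt (τ * σ) * ‖K‖) ^ 2 < 1 := by
      rw [mul_pow, Real.sq_sqrt (by positivity)]; exact hK
    rw [hγ]; nlinarith
  have hcoer : γ * (τ⁻¹ * ‖d.1‖ ^ 2 + σ⁻¹ * ‖d.2‖ ^ 2) ≤ qM K τ σ d := by
    rw [qM_eq]; exact inner_metricM_self_ge K hτ hσ (WithLp.toLp 2 d)
  have hτ'pos : 0 < τ' := lt_of_lt_of_le (by nlinarith) hτ'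
  have hσ'pos : 0 < σ' := lt_of_lt_of_le (by nlinarith) hσ'
  have hτinv : τ'⁻¹ ≤ (1 + 2 * φ) * τ⁻¹ := by
    rw [inv_eq_one_div, inv_eq_one_div, ← div_eq_mul_one_div, div_le_div_iff₀ hτ'pos hτ]
    nlinarith [mul_le_mul_of_nonneg_left hτ' (by linarith : (0 : ℝ) ≤ 1 + 2 * φ),
      mul_nonneg (mul_nonneg hφ0 (by linarith : (0 : ℝ) ≤ 1 - 2 * φ)) hτ.le]
  have hσinv : σ'⁻¹ ≤ (1 + 2 * φ) * σ⁻¹ := by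
    rw [inv_eq_one_div, inv_eq_one_div, ← div_eq_mul_one_div, div_le_div_iff₀ hσ'pos hσ]
    nlinarith [mul_le_mul_of_nonneg_left hσ' (by linarith : (0 : ℝ) ≤ 1 + 2 * φ),
      mul_nonneg (mul_nonneg hφ0 (by linarith : (0 : ℝ) ≤ 1 - 2 * φ)) hσ.le]
  have hdiff := qM_sub_qM K τ σ τ' σ' d
  have h1 : (τ'⁻¹ - τ⁻¹) * ‖d.1‖ ^ 2 ≤ 2 * φ * (τ⁻¹ * ‖d.1‖ ^ 2) := by
    nlinarith [sq_nonneg ‖d.1‖, mul_le_mul_of_nonneg_right hτinv (sq_nonneg ‖d.1‖)]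
  have h2 : (σ'⁻¹ - σ⁻¹) * ‖d.2‖ ^ 2 ≤ 2 * φ * (σ⁻¹ * ‖d.2‖ ^ 2) := by
    nlinarith [sq_nonneg ‖d.2‖, mul_le_mul_of_nonneg_right hσinv (sq_nonneg ‖d.2‖)]
  -- `qM' − qM ≤ 2φ E ≤ (2φ/γ) qM`
  have hE : τ⁻¹ * ‖d.1‖ ^ 2 + σ⁻¹ * ‖d.2‖ ^ 2 ≤ qM K τ σ d / γ := by
    rw [le_div_iff₀ hγpos, mul_comm]; exact hcoer
  have h3 : qM K τ' σ' d - qM K τ σ d ≤ 2 * φ * (qM K τ σ d / γ) := by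
    have := mul_le_mul_of_nonneg_left hE (by linarith : (0 : ℝ) ≤ 2 * φ)
    linarith
  have h4 : 2 * φ * (qM K τ σ d / γ) = 2 * φ / γ * qM K τ σ d := by
    field_simp
  rw [h4] at h3
  linarith

/-- **The variable-step (adaptive) PDHG iteration with relaxation**: `ζ^{k+1} = PD_{τ_k,σ_k}(z^k)` with
the resolvent maps `jA_k = J_{τ_k A}`, `jB_k = J_{σ_k B}` of the CURRENT steps, and
`z^{k+1} = z^k + ρ_k (ζ^{k+1} − z^k)` (`ρ_k ≡ 1` is [GLYEB, §2 Algorithm 1 "Basic PDHG"]: "`x_{k+1} =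
J_{τ_k F}(x_k − τ_k Aᵀ y_k)`, `y_{k+1} = J_{σ_k G}(y_k + σ_k A(2x_{k+1} − x_k))`").
[cite: GoldsteinEtAl2013, §2 Algorithm 1 (PDHG with steps τ_k, σ_k)] [cite: ChambollePock2015, §4.1 Algorithm 2 (22)] -/
noncomputable def varPdhgIter (K : X →L[ℝ] Y) (τ σ ρ : ℕ → ℝ) (jA : ℕ → X → X) (jB : ℕ → Y → Y)
    (z₀ : X × Y) : ℕ → X × Y
  | 0 => z₀
  | n + 1 => varPdhgIter K τ σ ρ jA jB z₀ n +
      ρ n • (pdhgStep K (τ n) (σ n) (jA n) (jB n) (varPdhgIter K τ σ ρ jA jB z₀ n) -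
        varPdhgIter K τ σ ρ jA jB z₀ n)

omit [CompleteSpace X] [CompleteSpace Y] in
/-- The recursion of `varPdhgIter`. [cite: GoldsteinEtAl2013, §2 Algorithm 1] -/
theorem varPdhgIter_succ [CompleteSpace X] [CompleteSpace Y] (K : X →L[ℝ] Y) (τ σ ρ : ℕ → ℝ)
    (jA : ℕ → X → X) (jB : ℕ → Y → Y) (z₀ : X × Y) (n : ℕ) :
    varPdhgIter K τ σ ρ jA jB z₀ (n + 1) = varPdhgIter K τ σ ρ jA jB z₀ n +
      ρ n • (pdhgStep K (τ n) (σ n) (jA n) (jB n) (varPdhgIter K τ σ ρ jA jB z₀ n) -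
        varPdhgIter K τ σ ρ jA jB z₀ n) := rfl

/-- **Variable-step PDHG converges to a saddle point** — [GLYEB, THEOREM 1] under (A) bounded steps
(here: `τ_k ∈ [τlo, τhi]`, `σ_k ∈ [σlo, σhi]` with positive floors), (B) `Σ_k φ_k < ∞`
(`φ_k = stepDecrease`), (C1) `τ_kσ_k‖K‖² ≤ ℓ < 1`; with relaxation factors `ρ_k ∈ [ρlo, ρhi] ⊂ (0,2)`
(`ρ_k ≡ 1` printed). Finite-dimensional `X`, `Y`; `A`, `B` monotone with resolvent maps `J_{τ_k A}`,
`J_{σ_k B}`; a saddle point exists. CONCLUSION: `z^k → z*` a saddle point (the printed conclusion is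
residual convergence, `tendsto_varPdhgIter_sub`; convergence of the iterates is the finite-dimensional
consequence of the same variable-metric Fejér inequality, [CV13, Thm 3.3]). Mechanism: after the index
`K₁` from which `φ_k ≤ ½`, the gauges `‖·‖_{M_k}` satisfy `‖d‖²_{M_{k+1}} ≤ (1 + 2φ_k/(1−√ℓ))‖d‖²_{M_k}`
(`qM_succ_le`) with uniform equivalence constants, each `PD_{τ_k,σ_k}` is firmly quasi-nonexpansive in
`‖·‖_{M_k}` towards every saddle point (`normM_pdhgStep_firm`), and cluster points are saddle points by
closedness of the graphs of `A`, `B` (`mem_zer_kkt_of_tendsto`); the engine `exists_tendsto_of_firm_varGauge`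
concludes. [cite: GoldsteinEtAl2013, §6.2 conditions (A) (B) (C1) and §6.7 Theorem 1]
[cite: CombettesVu2013, §3 Thm 3.3] [cite: EcksteinBertsekas1992, §3 Thm 3] -/
theorem tendsto_varPdhgIter [FiniteDimensional ℝ X] [FiniteDimensional ℝ Y] (K : X →L[ℝ] Y)
    {A : Set (X × X)} {B : Set (Y × Y)} (hA : IsMonotone A) (hB : IsMonotone B)
    {τ σ ρ : ℕ → ℝ} {jA : ℕ → X → X} {jB : ℕ → Y → Y}
    (hjA : ∀ k, IsResolventMap (τ k) A (jA k)) (hjB : ∀ k, IsResolventMap (σ k) B (jB k))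
    {τlo τhi σlo σhi ℓ : ℝ} (hτlo : 0 < τlo) (hσlo : 0 < σlo) (hτb : ∀ k, τlo ≤ τ k ∧ τ k ≤ τhi)
    (hσb : ∀ k, σlo ≤ σ k ∧ σ k ≤ σhi) (hℓ : ℓ < 1) (hC1 : ∀ k, τ k * σ k * ‖K‖ ^ 2 ≤ ℓ)
    (hBsum : Summable (stepDecrease τ σ)) {ρlo ρhi : ℝ} (hρlo : 0 < ρlo) (hρhi : ρhi < 2)
    (hρ : ∀ k, ρlo ≤ ρ k ∧ ρ k ≤ ρhi) (hsad : (zer (kkt K A B)).Nonempty) (z₀ : X × Y) :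
    ∃ zs : X × Y, WithLp.toLp 2 zs ∈ zer (kkt K A B) ∧
      Tendsto (varPdhgIter K τ σ ρ jA jB z₀) atTop (𝓝 zs) := by
  set z := varPdhgIter K τ σ ρ jA jB z₀ with hzdef
  -- positivity and (C1)
  have hτpos : ∀ k, 0 < τ k := fun k => hτlo.trans_le (hτb k).1
  have hσpos : ∀ k, 0 < σ k := fun k => hσlo.trans_le (hσb k).1
  have hτhi : 0 < τhi := (hτpos 0).trans_le (hτb 0).2
  have hσhi : 0 < σhi := (hσpos 0).trans_le (hσb 0).2
  have hKlt : ∀ k, τ k * σ k * ‖K‖ ^ 2 < 1 := fun k => (hC1 k).trans_lt hℓ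
  -- the uniform coercivity constant `γ₀ = 1 − √ℓ`
  set γ₀ : ℝ := 1 - Real.sqrt ℓ with hγ₀
  have hsqrtℓ : Real.sqrt ℓ < 1 := by
    rw [show (1 : ℝ) = Real.sqrt 1 by simp]
    exact Real.sqrt_lt_sqrt
      (le_trans (mul_nonneg (mul_nonneg (hτpos 0).le (hσpos 0).le) (sq_nonneg _)) (hC1 0)) hℓ
  have hγ₀pos : 0 < γ₀ := by rw [hγ₀]; linarith
  have hγk : ∀ k, γ₀ ≤ 1 - Real.sqrt (τ k * σ k) * ‖K‖ := fun k => by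
    have h1 : Real.sqrt (τ k * σ k) * ‖K‖ = Real.sqrt (τ k * σ k * ‖K‖ ^ 2) := by
      rw [Real.sqrt_mul' _ (sq_nonneg _), Real.sqrt_sq (norm_nonneg _)]
    rw [h1, hγ₀]
    linarith [Real.sqrt_le_sqrt (hC1 k)]
  -- uniform gauge constants
  set m₀ : ℝ := Real.sqrt (γ₀ * min τhi⁻¹ σhi⁻¹) with hm₀
  set Mu₀ : ℝ := Real.sqrt (τlo⁻¹ + σlo⁻¹ + 2 * ‖K‖) with hMu₀
  have hmin0 : 0 < min τhi⁻¹ σhi⁻¹ := lt_min (inv_pos.2 hτhi) (inv_pos.2 hσhi)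
  have hm₀pos : 0 < m₀ := Real.sqrt_pos.2 (mul_pos hγ₀pos hmin0)
  have hgauge : ∀ k, IsEuclideanGauge (E := X × Y) (normM K (τ k) (σ k)) m₀ Mu₀ := fun k => by
    refine isEuclideanGauge_of_le (isEuclideanGauge_normM K (hτpos k) (hσpos k) (hKlt k)) hm₀pos ?_ ?_
    · refine Real.sqrt_le_sqrt (mul_le_mul (hγk k) ?_ hmin0.le ?_)
      · exact le_min ((min_le_left _ _).trans (inv_anti₀ (hτpos k) (hτb k).2))
          ((min_le_right _ _).trans (inv_anti₀ (hσpos k) (hσb k).2))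
      · exact hγ₀pos.le.trans (hγk k)
    · refine Real.sqrt_le_sqrt (add_le_add (add_le_add ?_ ?_) le_rfl)
      · exact inv_anti₀ hτlo (hτb k).1
      · exact inv_anti₀ hσlo (hσb k).1
  -- the target set
  set F : Set (X × Y) := {u | WithLp.toLp 2 u ∈ zer (kkt K A B)} with hF
  have hFne : F.Nonempty := by
    obtain ⟨ps, hps⟩ := hsad
    exact ⟨WithLp.ofLp ps, by simpa [hF] using hps⟩
  have hfirm : ∀ k, ∀ y ∈ F, ∀ u : X × Y,
      normM K (τ k) (σ k) (pdhgStep K (τ k) (σ k) (jA k) (jB k) u - y) ^ 2 +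
        normM K (τ k) (σ k) (u - pdhgStep K (τ k) (σ k) (jA k) (jB k) u) ^ 2 ≤
        normM K (τ k) (σ k) (u - y) ^ 2 := fun k y hy u =>
    normM_pdhgStep_firm K (hτpos k) (hσpos k) (hKlt k).le hA hB (hjA k) (hjB k) hy u
  -- (B): eventually `φ_k ≤ ½`
  obtain ⟨K₁, hK₁⟩ : ∃ K₁, ∀ k ≥ K₁, stepDecrease τ σ k ≤ 2⁻¹ := by
    have h := hBsum.tendsto_atTop_zero
    exact eventually_atTop.1 (h.eventually (eventually_le_nhds (by norm_num : (0:ℝ) < 2⁻¹)))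
  -- the shifted data
  set x' : ℕ → X × Y := fun j => z (K₁ + j) with hx'
  set N' : ℕ → X × Y → ℝ := fun j => normM K (τ (K₁ + j)) (σ (K₁ + j)) with hN'
  set f' : ℕ → X × Y → X × Y :=
    fun j => pdhgStep K (τ (K₁ + j)) (σ (K₁ + j)) (jA (K₁ + j)) (jB (K₁ + j)) with hf'
  set η' : ℕ → ℝ := fun j => 2 * stepDecrease τ σ (K₁ + j) / γ₀ with hη'
  have hη'0 : ∀ j, 0 ≤ η' j := fun j =>
    div_nonneg (mul_nonneg zero_le_two (stepDecrease_nonneg τ σ _)) hγ₀pos.le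
  have hη's : Summable η' := by
    have h1 : Summable fun j => stepDecrease τ σ (K₁ + j) := by
      have := (summable_nat_add_iff K₁).2 hBsum
      simpa [add_comm] using this
    simpa [hη', mul_div_assoc, div_eq_mul_inv, mul_comm, mul_left_comm, mul_assoc] using
      (h1.mul_left (2 / γ₀))
  have hmono : ∀ j d, N' (j + 1) d ^ 2 ≤ (1 + η' j) * N' j d ^ 2 := fun j d => by
    have hk : K₁ + (j + 1) = K₁ + j + 1 := rfl
    simp only [hN', hk]
    rw [normM_sq K (hτpos _) (hσpos _) (hKlt _).le, normM_sq K (hτpos _) (hσpos _) (hKlt _).le]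
    have hφ := hK₁ (K₁ + j) (Nat.le_add_right _ _)
    have h := qM_succ_le K (hτpos (K₁ + j)) (hσpos (K₁ + j)) (hKlt (K₁ + j))
      (stepDecrease_nonneg τ σ _) hφ (one_sub_stepDecrease_mul_le_tau (hτpos _))
      (one_sub_stepDecrease_mul_le_sigma (hσpos _)) d
    refine h.trans (mul_le_mul_of_nonneg_right ?_ (qM_nonneg K (hτpos _) (hσpos _) (hKlt _).le d))
    have : 2 * stepDecrease τ σ (K₁ + j) / (1 - Real.sqrt (τ (K₁ + j) * σ (K₁ + j)) * ‖K‖) ≤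
        η' j :=
      div_le_div_of_nonneg_left (mul_nonneg zero_le_two (stepDecrease_nonneg τ σ _)) hγ₀pos (hγk _)
    linarith
  have hx'succ : ∀ j, x' (j + 1) = x' j + ρ (K₁ + j) • (f' j (x' j) - x' j) := fun j => rfl
  have hfirm' : ∀ j, ∀ y ∈ F, ∀ u : X × Y,
      N' j (f' j u - y) ^ 2 + N' j (u - f' j u) ^ 2 ≤ N' j (u - y) ^ 2 := fun j y hy u =>
    hfirm (K₁ + j) y hy u
  -- closedness of the graphs
  have hAc : IsClosed A := isClosed_of_isResolventMap (hjA 0) hA (hτpos 0)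
  have hBc : IsClosed B := isClosed_of_isResolventMap (hjB 0) hB (hσpos 0)
  -- the closure hypothesis of the engine
  have hclos : ∀ (q : X × Y) (φ : ℕ → ℕ), StrictMono φ → Tendsto (x' ∘ φ) atTop (𝓝 q) →
      Tendsto (fun j => f' (φ j) (x' (φ j)) - x' (φ j)) atTop (𝓝 0) → q ∈ F := by
    intro q φ hφ hlim hres
    -- `u_j = PD(x'_{φ j}) → q`
    set u : ℕ → X × Y := fun j => f' (φ j) (x' (φ j)) with hu
    have hulim : Tendsto u atTop (𝓝 q) := by
      have : Tendsto (fun j => (f' (φ j) (x' (φ j)) - x' (φ j)) + x' (φ j)) atTop (𝓝 (0 + q)) :=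
        hres.add hlim
      simpa [hu] using this
    have hdiff : Tendsto (fun j => x' (φ j) - u j) atTop (𝓝 0) := by
      have := hlim.sub hulim
      simpa [hu] using this
    -- the KKT pairs `(u_j, M_k (x' − u_j)) ∈ F`
    set a : ℕ → X := fun j => (τ (K₁ + φ j))⁻¹ • (x' (φ j) - u j).1 -
      K.adjoint (x' (φ j) - u j).2 - K.adjoint (u j).2 with ha
    set b' : ℕ → Y := fun j => (σ (K₁ + φ j))⁻¹ • (x' (φ j) - u j).2 -
      K (x' (φ j) - u j).1 + K (u j).1 with hb'
    have hmem : ∀ j, ((u j).1, a j) ∈ A ∧ ((u j).2, b' j) ∈ B := fun j => by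
      have h := pdhgStep_mem_kkt K (hτpos (K₁ + φ j)).ne' (hσpos (K₁ + φ j)).ne' (hjA _) (hjB _)
        (x' (φ j))
      obtain ⟨a₀, b₀, ha₀, hb₀, h1, h2⟩ := mem_kkt_iff.1 h
      rw [metricM_fst] at h1
      rw [metricM_snd] at h2
      simp only [WithLp.toLp_fst, WithLp.toLp_snd, WithLp.sub_fst, WithLp.sub_snd] at h1 h2 ha₀ hb₀
      constructor
      · convert ha₀ using 2
        simp only [ha, hu, Prod.fst_sub, Prod.snd_sub]
        rw [eq_sub_iff_add_eq.mpr h1.symm]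
      · convert hb₀ using 2
        simp only [hb', hu, Prod.fst_sub, Prod.snd_sub]
        rw [(sub_eq_iff_eq_add.mp h2.symm)]
    -- limits of `a_j`, `b'_j`
    have hd1 : Tendsto (fun j => (x' (φ j) - u j).1) atTop (𝓝 0) := by
      have h := (continuous_fst.tendsto (0 : X × Y)).comp hdiff
      rw [Prod.fst_zero] at h
      exact h
    have hd2 : Tendsto (fun j => (x' (φ j) - u j).2) atTop (𝓝 0) := by
      have h := (continuous_snd.tendsto (0 : X × Y)).comp hdiff
      rw [Prod.snd_zero] at h
      exact h
    have hsm1 : Tendsto (fun j => (τ (K₁ + φ j))⁻¹ • (x' (φ j) - u j).1) atTop (𝓝 0) := by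
      rw [tendsto_iff_norm_sub_tendsto_zero]
      simp only [sub_zero]
      have hb : ∀ j, ‖(τ (K₁ + φ j))⁻¹ • (x' (φ j) - u j).1‖ ≤ τlo⁻¹ * ‖(x' (φ j) - u j).1‖ :=
        fun j => by
        rw [norm_smul, Real.norm_eq_abs, abs_of_pos (inv_pos.2 (hτpos _))]
        exact mul_le_mul_of_nonneg_right (inv_anti₀ hτlo (hτb _).1) (norm_nonneg _)
      refine squeeze_zero (fun j => norm_nonneg _) hb ?_
      simpa using (tendsto_iff_norm_sub_tendsto_zero.1 hd1).const_mul τlo⁻¹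
    have hsm2 : Tendsto (fun j => (σ (K₁ + φ j))⁻¹ • (x' (φ j) - u j).2) atTop (𝓝 0) := by
      rw [tendsto_iff_norm_sub_tendsto_zero]
      simp only [sub_zero]
      have hb : ∀ j, ‖(σ (K₁ + φ j))⁻¹ • (x' (φ j) - u j).2‖ ≤ σlo⁻¹ * ‖(x' (φ j) - u j).2‖ :=
        fun j => by
        rw [norm_smul, Real.norm_eq_abs, abs_of_pos (inv_pos.2 (hσpos _))]
        exact mul_le_mul_of_nonneg_right (inv_anti₀ hσlo (hσb _).1) (norm_nonneg _)
      refine squeeze_zero (fun j => norm_nonneg _) hb ?_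
      simpa using (tendsto_iff_norm_sub_tendsto_zero.1 hd2).const_mul σlo⁻¹
    have hu1 : Tendsto (fun j => (u j).1) atTop (𝓝 q.1) := (continuous_fst.tendsto q).comp hulim
    have hu2 : Tendsto (fun j => (u j).2) atTop (𝓝 q.2) := (continuous_snd.tendsto q).comp hulim
    have halim : Tendsto a atTop (𝓝 (-K.adjoint q.2)) := by
      have h := (hsm1.sub ((K.adjoint.continuous.tendsto 0).comp hd2)).sub
        ((K.adjoint.continuous.tendsto q.2).comp hu2)
      simpa [ha, Function.comp_def] using h
    have hblim : Tendsto b' atTop (𝓝 (K q.1)) := by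
      have h := (hsm2.sub ((K.continuous.tendsto 0).comp hd1)).add
        ((K.continuous.tendsto q.1).comp hu1)
      simpa [hb', Function.comp_def] using h
    exact mem_zer_kkt_of_tendsto K hAc hBc (fun j => (hmem j).1) (fun j => (hmem j).2) hulim
      halim hblim
  -- run the engine on the shifted data
  obtain ⟨q, hq, hlim⟩ := exists_tendsto_of_firm_varGauge (N := N') (η := η') (f := f') (F := F)
    (ρ := fun j => ρ (K₁ + j)) (x := x') (fun j => hgauge (K₁ + j)) hη'0 hη's hmono hFne hfirm'
    hρlo hρhi (fun j => hρ (K₁ + j)) hx'succ hclos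
  refine ⟨q, hq, ?_⟩
  rw [← tendsto_add_atTop_iff_nat K₁]
  have : (fun n => z (n + K₁)) = x' := by funext n; simp [hx', add_comm]
  rw [this]; exact hlim

/-- **[GLYEB, Thm 1] as printed — "the algorithm converges in the residuals"**: under the hypotheses
of `tendsto_varPdhgIter`, `z^{k+1} − z^k → 0` (hence the primal and dual residuals `P_k`, `D_k`, which
are bounded multiples of the step, tend to zero). [cite: GoldsteinEtAl2013, §6.7 Theorem 1] -/
theorem tendsto_varPdhgIter_sub [FiniteDimensional ℝ X] [FiniteDimensional ℝ Y] (K : X →L[ℝ] Y)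
    {A : Set (X × X)} {B : Set (Y × Y)} (hA : IsMonotone A) (hB : IsMonotone B)
    {τ σ ρ : ℕ → ℝ} {jA : ℕ → X → X} {jB : ℕ → Y → Y}
    (hjA : ∀ k, IsResolventMap (τ k) A (jA k)) (hjB : ∀ k, IsResolventMap (σ k) B (jB k))
    {τlo τhi σlo σhi ℓ : ℝ} (hτlo : 0 < τlo) (hσlo : 0 < σlo) (hτb : ∀ k, τlo ≤ τ k ∧ τ k ≤ τhi)
    (hσb : ∀ k, σlo ≤ σ k ∧ σ k ≤ σhi) (hℓ : ℓ < 1) (hC1 : ∀ k, τ k * σ k * ‖K‖ ^ 2 ≤ ℓ)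
    (hBsum : Summable (stepDecrease τ σ)) {ρlo ρhi : ℝ} (hρlo : 0 < ρlo) (hρhi : ρhi < 2)
    (hρ : ∀ k, ρlo ≤ ρ k ∧ ρ k ≤ ρhi) (hsad : (zer (kkt K A B)).Nonempty) (z₀ : X × Y) :
    Tendsto (fun k => varPdhgIter K τ σ ρ jA jB z₀ (k + 1) - varPdhgIter K τ σ ρ jA jB z₀ k)
      atTop (𝓝 0) := by
  obtain ⟨zs, -, hlim⟩ := tendsto_varPdhgIter K hA hB hjA hjB hτlo hσlo hτb hσb hℓ hC1 hBsum hρlo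
    hρhi hρ hsad z₀
  have h := (hlim.comp (tendsto_add_atTop_nat 1)).sub hlim
  rw [sub_self] at h
  exact h

/-- **The conic / projection form with variable steps** (the PDLP-type kernel with a step-size /
primal-weight SCHEDULE): resolvent maps `x ↦ P_C(x − τ_k c)`, `y ↦ P_D(y − σ_k b)` at step `k`;
(A)+(C1) as bounds `τ_k ∈ [τlo, τhi]`, `σ_k ∈ [σlo, σhi]`, `τ_kσ_k‖K‖² ≤ ℓ < 1`; (B) `Σ φ_k < ∞`;
`ρ_k ∈ [ρlo, ρhi] ⊂ (0,2)`; a saddle point exists ⇒ the iterates converge to a saddle point.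
[cite: GoldsteinEtAl2013, §6.2 (A) (B) (C1) and §6.7 Theorem 1] [cite: ChambollePock2010, Theorem 1 (c)] -/
theorem tendsto_varPdhgIter_conic [FiniteDimensional ℝ X] [FiniteDimensional ℝ Y] (K : X →L[ℝ] Y)
    {C : Set X} {D : Set Y} (hCne : C.Nonempty) (hCcl : IsClosed C) (hCc : Convex ℝ C)
    (hDne : D.Nonempty) (hDcl : IsClosed D) (hDc : Convex ℝ D) (c : X) (b : Y) {τ σ ρ : ℕ → ℝ}
    {τlo τhi σlo σhi ℓ : ℝ} (hτlo : 0 < τlo) (hσlo : 0 < σlo) (hτb : ∀ k, τlo ≤ τ k ∧ τ k ≤ τhi)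
    (hσb : ∀ k, σlo ≤ σ k ∧ σ k ≤ σhi) (hℓ : ℓ < 1) (hC1 : ∀ k, τ k * σ k * ‖K‖ ^ 2 ≤ ℓ)
    (hBsum : Summable (stepDecrease τ σ)) {ρlo ρhi : ℝ} (hρlo : 0 < ρlo) (hρhi : ρhi < 2)
    (hρ : ∀ k, ρlo ≤ ρ k ∧ ρ k ≤ ρhi)
    (hsad : (zer (kkt K (shiftOp c (normalCone C)) (shiftOp b (normalCone D)))).Nonempty)
    (z₀ : X × Y) :
    ∃ zs : X × Y, WithLp.toLp 2 zs ∈ zer (kkt K (shiftOp c (normalCone C)) (shiftOp b (normalCone D)))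
      ∧ Tendsto (varPdhgIter K τ σ ρ (fun k x => proj C (x - τ k • c))
          (fun k y => proj D (y - σ k • b)) z₀) atTop (𝓝 zs) :=
  have hτpos : ∀ k, 0 < τ k := fun k => hτlo.trans_le (hτb k).1
  have hσpos : ∀ k, 0 < σ k := fun k => hσlo.trans_le (hσb k).1
  tendsto_varPdhgIter K (isMonotone_shiftOp c (isMonotone_normalCone C))
    (isMonotone_shiftOp b (isMonotone_normalCone D))
    (fun k => isResolventMap_shiftOp (isResolventMap_proj hCne hCcl.isComplete hCc (hτpos k)))
    (fun k => isResolventMap_shiftOp (isResolventMap_proj hDne hDcl.isComplete hDc (hσpos k)))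
    hτlo hσlo hτb hσb hℓ hC1 hBsum hρlo hρhi hρ hsad z₀

/-- **Primal-weight schedules** (the PDLP parametrization `τ_k = s/ω_k`, `σ_k = s·ω_k`, so that
`τ_kσ_k = s²` is constant — exactly [GLYEB, Alg. 2]'s "the product `τ_kσ_k` remains unchanged at each
iteration" (§6.3), its residual balancing moving only the ratio): if `s > 0`, `s²‖K‖² < 1` [(C1)],
`ω_k ∈ [ωlo, ωhi]` with `ωlo > 0` [(A)], and the primal weight has SUMMABLE VARIATION `Σ_k |ω_{k+1} − ω_k| < ∞`
[(B): then `φ_k ≤ |ω_{k+1} − ω_k|/ωlo`], then variable-step PDHG (with relaxation `ρ_k ∈ [ρlo,ρhi] ⊂ (0,2)`)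
converges to a saddle point. An eventually frozen primal weight, or one updated with geometrically
decreasing aggressiveness ([GLYEB, Alg. 2]: `α_{k+1} = ηα_k`), has summable variation; a weight
re-balanced forever with a constant smoothing factor carries no such guarantee (and no theorem here).
[cite: GoldsteinEtAl2013, §5.1 Algorithm 2 and §6.3 (τ_kσ_k = τ_0σ_0; φ_k = α_k geometric ⇒ (B))]
[cite: GoldsteinEtAl2013, §6.7 Theorem 1] -/
theorem tendsto_varPdhgIter_primalWeight [FiniteDimensional ℝ X] [FiniteDimensional ℝ Y]
    (K : X →L[ℝ] Y) {A : Set (X × X)} {B : Set (Y × Y)} (hA : IsMonotone A) (hB : IsMonotone B)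
    {s : ℝ} (hs : 0 < s) (hsK : s ^ 2 * ‖K‖ ^ 2 < 1) {ω : ℕ → ℝ} {ωlo ωhi : ℝ} (hωlo : 0 < ωlo)
    (hωb : ∀ k, ωlo ≤ ω k ∧ ω k ≤ ωhi) (hωsum : Summable fun k => |ω (k + 1) - ω k|)
    {ρ : ℕ → ℝ} {jA : ℕ → X → X} {jB : ℕ → Y → Y}
    (hjA : ∀ k, IsResolventMap (s / ω k) A (jA k)) (hjB : ∀ k, IsResolventMap (s * ω k) B (jB k))
    {ρlo ρhi : ℝ} (hρlo : 0 < ρlo) (hρhi : ρhi < 2) (hρ : ∀ k, ρlo ≤ ρ k ∧ ρ k ≤ ρhi)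
    (hsad : (zer (kkt K A B)).Nonempty) (z₀ : X × Y) :
    ∃ zs : X × Y, WithLp.toLp 2 zs ∈ zer (kkt K A B) ∧
      Tendsto (varPdhgIter K (fun k => s / ω k) (fun k => s * ω k) ρ jA jB z₀) atTop (𝓝 zs) := by
  have hωpos : ∀ k, 0 < ω k := fun k => hωlo.trans_le (hωb k).1
  have hωhi : 0 < ωhi := (hωpos 0).trans_le (hωb 0).2
  -- (A): bounds
  have hτb : ∀ k, s / ωhi ≤ s / ω k ∧ s / ω k ≤ s / ωlo := fun k =>
    ⟨div_le_div_of_nonneg_left hs.le (hωpos k) (hωb k).2,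
      div_le_div_of_nonneg_left hs.le hωlo (hωb k).1⟩
  have hσb : ∀ k, s * ωlo ≤ s * ω k ∧ s * ω k ≤ s * ωhi := fun k =>
    ⟨mul_le_mul_of_nonneg_left (hωb k).1 hs.le, mul_le_mul_of_nonneg_left (hωb k).2 hs.le⟩
  -- (C1): `τ_kσ_k‖K‖² = s²‖K‖²`
  have hC1 : ∀ k, s / ω k * (s * ω k) * ‖K‖ ^ 2 ≤ s ^ 2 * ‖K‖ ^ 2 := fun k => by
    have : s / ω k * (s * ω k) = s ^ 2 := by field_simp [(hωpos k).ne']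
    rw [this]
  -- (B): `φ_k ≤ |ω_{k+1} − ω_k| / ωlo`
  have hφle : ∀ k, stepDecrease (fun k => s / ω k) (fun k => s * ω k) k ≤ |ω (k + 1) - ω k| / ωlo :=
    fun k => by
    have hk := hωpos k
    have hk1 := hωpos (k + 1)
    refine max_le (max_le ?_ ?_) (div_nonneg (abs_nonneg _) hωlo.le)
    · have e : (s / ω k - s / ω (k + 1)) / (s / ω k) = (ω (k + 1) - ω k) / ω (k + 1) := by
        field_simp
      rw [e]
      exact (div_le_div_of_nonneg_right (le_abs_self _) hk1.le).trans
        (div_le_div_of_nonneg_left (abs_nonneg _) hωlo (hωb (k + 1)).1)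
    · have e : (s * ω k - s * ω (k + 1)) / (s * ω k) = (ω k - ω (k + 1)) / ω k := by
        field_simp
      rw [e]
      have h1 : ω k - ω (k + 1) ≤ |ω (k + 1) - ω k| := by
        rw [abs_sub_comm]; exact le_abs_self _
      exact (div_le_div_of_nonneg_right h1 hk.le).trans
        (div_le_div_of_nonneg_left (abs_nonneg _) hωlo (hωb k).1)
  have hBsum : Summable (stepDecrease (fun k => s / ω k) (fun k => s * ω k)) :=
    Summable.of_nonneg_of_le (stepDecrease_nonneg _ _) hφle (hωsum.div_const ωlo)
  exact tendsto_varPdhgIter K hA hB hjA hjB (div_pos hs hωhi) (mul_pos hs hωlo) hτb hσb hsK hC1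
    hBsum hρlo hρhi hρ hsad z₀

end VariableSteps

/-! ## §6 Inexact steps: summable resolvent errors ([EB92, Thm 3 and Thm 7] with the error sequences
`ε_k`, `α_k`, `β_k`) -/

section Inexact

variable {E : Type*} [NormedAddCommGroup E] [NormedSpace ℝ E]

/-- The relaxed step of a firmly quasi-nonexpansive map does not increase the gauge distance to the
target: `N(z + ρ(fz − z) − y) ≤ N(z − y)` for `0 ≤ ρ ≤ 2`. [cite: EcksteinBertsekas1992, §3 Thm 3 (proof)] -/
theorem gauge_relaxStep_le {N : E → ℝ} {m Mu : ℝ} (hN : IsEuclideanGauge N m Mu) {f : E → E}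
    {ρ : ℝ} (hρ0 : 0 ≤ ρ) (hρ2 : ρ ≤ 2) {y z : E}
    (hfirm : N (f z - y) ^ 2 + N (z - f z) ^ 2 ≤ N (z - y) ^ 2) :
    N ((z + ρ • (f z - z)) - y) ≤ N (z - y) := by
  have h := gauge_relaxStep_sq_le hN hρ0 hfirm
  have h2 : 0 ≤ ρ * (2 - ρ) * N (f z - z) ^ 2 :=
    mul_nonneg (mul_nonneg hρ0 (by linarith)) (sq_nonneg _)
  exact (pow_le_pow_iff_left₀ (hN.nonneg _) (hN.nonneg _) two_ne_zero).1 (by linarith)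

variable {N : ℕ → E → ℝ} {m Mu : ℝ} {η : ℕ → ℝ} {F : Set E} {f : ℕ → E → E} {ρ : ℕ → ℝ}
  {ρlo ρhi : ℝ} {x w : ℕ → E} {ε : ℕ → ℝ}

/-- From `N_{k+1}(d)² ≤ (1+η_k)N_k(d)²` (`η_k ≥ 0`): `N_{k+1}(d) ≤ (1+η_k)N_k(d)`.
[cite: CombettesVu2013, §3 Definition 3.1] -/
theorem gauge_succ_le_mul (hN : ∀ k, IsEuclideanGauge (N k) m Mu) (hη : ∀ k, 0 ≤ η k)
    (hmono : ∀ k d, N (k + 1) d ^ 2 ≤ (1 + η k) * N k d ^ 2) (k : ℕ) (d : E) :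
    N (k + 1) d ≤ (1 + η k) * N k d := by
  have h1 : N (k + 1) d ^ 2 ≤ ((1 + η k) * N k d) ^ 2 := by
    refine (hmono k d).trans ?_
    rw [mul_pow]
    have : (1 + η k) ≤ (1 + η k) ^ 2 := by nlinarith [hη k]
    exact mul_le_mul_of_nonneg_right this (sq_nonneg _)
  exact (pow_le_pow_iff_left₀ ((hN _).nonneg _) (mul_nonneg (by linarith [hη k]) ((hN _).nonneg _))
    two_ne_zero).1 h1

/-- **One INEXACT relaxed step** `x^{k+1} = x^k + ρ_k(w^k − x^k)` with `N_k(w^k − f_k x^k) ≤ ε_k`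
("`‖w^k − (I + c_kT)⁻¹(z^k)‖ ≤ ε_k`"), `ρ_k ∈ [ρlo, ρhi] ⊂ [0, 2]`:
`N_k(x^{k+1} − y) ≤ N_k(x^k − y) + 2ε_k`. [cite: EcksteinBertsekas1992, §3 Thm 3 (proof)] -/
theorem gauge_inexact_succ_le (hN : ∀ k, IsEuclideanGauge (N k) m Mu) (hρlo : 0 ≤ ρlo) (hρhi : ρhi ≤ 2)
    (hρ : ∀ k, ρlo ≤ ρ k ∧ ρ k ≤ ρhi) (hε : ∀ k, 0 ≤ ε k) (hw : ∀ k, N k (w k - f k (x k)) ≤ ε k)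
    (hx : ∀ k, x (k + 1) = x k + ρ k • (w k - x k)) {y : E}
    (hfirm : ∀ k z, N k (f k z - y) ^ 2 + N k (z - f k z) ^ 2 ≤ N k (z - y) ^ 2) (k : ℕ) :
    N k (x (k + 1) - y) ≤ N k (x k - y) + 2 * ε k := by
  obtain ⟨h1, h2⟩ := hρ k
  have hρ0 : 0 ≤ ρ k := hρlo.trans h1
  have e : x (k + 1) - y =
      ((x k + ρ k • (f k (x k) - x k)) - y) + ρ k • (w k - f k (x k)) := by
    rw [hx k]; module
  rw [e]
  calc N k (((x k + ρ k • (f k (x k) - x k)) - y) + ρ k • (w k - f k (x k)))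
        ≤ N k ((x k + ρ k • (f k (x k) - x k)) - y) + N k (ρ k • (w k - f k (x k))) :=
          (hN k).add_le _ _
    _ ≤ N k (x k - y) + ρ k * ε k := by
          refine add_le_add (gauge_relaxStep_le (hN k) hρ0 (h2.trans hρhi) (hfirm k (x k))) ?_
          rw [(hN k).smul, abs_of_nonneg hρ0]
          exact mul_le_mul_of_nonneg_left (hw k) hρ0
    _ ≤ N k (x k - y) + 2 * ε k := by nlinarith [hε k]

/-- **Variable-metric quasi-Fejér inequality with summable errors**:
`N_{k+1}(x^{k+1} − y) ≤ (1+η_k) N_k(x^k − y) + 2(1+η_k)ε_k`. [cite: CombettesVu2013, §3 Definition 3.1 (η_n, ε_n)]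
[cite: EcksteinBertsekas1992, §3 Thm 3 (proof)] -/
theorem gauge_inexact_succ_le_mul (hN : ∀ k, IsEuclideanGauge (N k) m Mu) (hη : ∀ k, 0 ≤ η k)
    (hmono : ∀ k d, N (k + 1) d ^ 2 ≤ (1 + η k) * N k d ^ 2) (hρlo : 0 ≤ ρlo) (hρhi : ρhi ≤ 2)
    (hρ : ∀ k, ρlo ≤ ρ k ∧ ρ k ≤ ρhi) (hε : ∀ k, 0 ≤ ε k) (hw : ∀ k, N k (w k - f k (x k)) ≤ ε k)
    (hx : ∀ k, x (k + 1) = x k + ρ k • (w k - x k)) {y : E}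
    (hfirm : ∀ k z, N k (f k z - y) ^ 2 + N k (z - f k z) ^ 2 ≤ N k (z - y) ^ 2) (k : ℕ) :
    N (k + 1) (x (k + 1) - y) ≤ (1 + η k) * N k (x k - y) + 2 * (1 + η k) * ε k := by
  have h1 := gauge_inexact_succ_le hN hρlo hρhi hρ hε hw hx hfirm k
  have h2 := gauge_succ_le_mul hN hη hmono k (x (k + 1) - y)
  have h3 := mul_le_mul_of_nonneg_left h1 (by linarith [hη k] : (0 : ℝ) ≤ 1 + η k)
  linarith

/-- Boundedness of `N_k(x^k − y)` along the inexact scheme (a uniform bound `B ≥ 0`).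
[cite: CombettesVu2013, §3 Prop 3.2 (i)–(ii)] [cite: EcksteinBertsekas1992, §3 Thm 3 (proof: {z^k} bounded)] -/
theorem gauge_inexact_bound (hN : ∀ k, IsEuclideanGauge (N k) m Mu) (hη : ∀ k, 0 ≤ η k)
    (hηs : Summable η) (hmono : ∀ k d, N (k + 1) d ^ 2 ≤ (1 + η k) * N k d ^ 2) (hρlo : 0 ≤ ρlo)
    (hρhi : ρhi ≤ 2) (hρ : ∀ k, ρlo ≤ ρ k ∧ ρ k ≤ ρhi) (hε : ∀ k, 0 ≤ ε k) (hεs : Summable ε)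
    (hw : ∀ k, N k (w k - f k (x k)) ≤ ε k) (hx : ∀ k, x (k + 1) = x k + ρ k • (w k - x k)) {y : E}
    (hfirm : ∀ k z, N k (f k z - y) ^ 2 + N k (z - f k z) ^ 2 ≤ N k (z - y) ^ 2) :
    ∃ B : ℝ, 0 ≤ B ∧ ∀ k, N k (x k - y) ≤ B := by
  set S : ℝ := ∑' i, η i with hS
  have hηle : ∀ k, η k ≤ S := fun k => hηs.le_tsum k (fun j _ => hη j)
  set ε' : ℕ → ℝ := fun k => 2 * (1 + η k) * ε k with hε'
  have hε'0 : ∀ k, 0 ≤ ε' k := fun k => mul_nonneg (mul_nonneg zero_le_two (by linarith [hη k])) (hε k)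
  have hε's : Summable ε' := by
    refine Summable.of_nonneg_of_le hε'0 (fun k => ?_) ((hεs.mul_left (2 * (1 + S))))
    simp only [hε']
    have := hηle k
    nlinarith [hε k]
  have hrec : ∀ k, N (k + 1) (x (k + 1) - y) ≤ (1 + η k) * N k (x k - y) + ε' k := fun k =>
    gauge_inexact_succ_le_mul hN hη hmono hρlo hρhi hρ hε hw hx hfirm k
  refine ⟨Real.exp (∑' i, η i) * (N 0 (x 0 - y) + ∑' i, ε' i),
    mul_nonneg (Real.exp_nonneg _) (add_nonneg ((hN 0).nonneg _) (tsum_nonneg hε'0)), fun k => ?_⟩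
  exact le_exp_tsum_mul_of_le_mul_add (a := fun k => N k (x k - y)) (fun k => (hN k).nonneg _) hη hε'0
    hηs hε's hrec k

/-- **Square-summability of the exact-step residuals along the INEXACT scheme**:
`Σ_k N_k(f_k x^k − x^k)² < ∞` (for `ρlo > 0`, `ρhi < 2`, summable `η`, `ε`).
[cite: EcksteinBertsekas1992, §3 Thm 3 (proof: Σ‖Q_k(z^k)‖² < ∞)] -/
theorem summable_gauge_resid_sq_inexact (hN : ∀ k, IsEuclideanGauge (N k) m Mu) (hη : ∀ k, 0 ≤ η k)
    (hηs : Summable η) (hmono : ∀ k d, N (k + 1) d ^ 2 ≤ (1 + η k) * N k d ^ 2) (hρlo : 0 < ρlo)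
    (hρhi : ρhi < 2) (hρ : ∀ k, ρlo ≤ ρ k ∧ ρ k ≤ ρhi) (hε : ∀ k, 0 ≤ ε k) (hεs : Summable ε)
    (hw : ∀ k, N k (w k - f k (x k)) ≤ ε k) (hx : ∀ k, x (k + 1) = x k + ρ k • (w k - x k)) {y : E}
    (hfirm : ∀ k z, N k (f k z - y) ^ 2 + N k (z - f k z) ^ 2 ≤ N k (z - y) ^ 2) :
    Summable fun k => N k (f k (x k) - x k) ^ 2 := by
  obtain ⟨B, hB0, hB⟩ := gauge_inexact_bound hN hη hηs hmono hρlo.le hρhi.le hρ hε hεs hw hx hfirm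
  set S : ℝ := ∑' i, η i with hS
  have hS0 : 0 ≤ S := tsum_nonneg hη
  have hηle : ∀ k, η k ≤ S := fun k => hηs.le_tsum k (fun j _ => hη j)
  set Es : ℝ := ∑' i, ε i with hEs
  have hEs0 : 0 ≤ Es := tsum_nonneg hε
  have hBE : 0 ≤ 4 * (B + Es) := mul_nonneg (by norm_num) (add_nonneg hB0 hEs0)
  have hεle : ∀ k, ε k ≤ Es := fun k => hεs.le_tsum k (fun j _ => hε j)
  set c : ℝ := ρlo * (2 - ρhi) with hc
  have hc0 : 0 < c := mul_pos hρlo (by linarith)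
  set s : ℕ → ℝ := fun k => N k (x k - y) ^ 2 with hs
  set r : ℕ → ℝ := fun k => N k (f k (x k) - x k) ^ 2 with hr
  -- the squared one-step inequality with error, in the metric `N_k`
  have hsq : ∀ k, N k (x (k + 1) - y) ^ 2 ≤ s k - c * r k + 4 * (B + Es) * ε k := fun k => by
    obtain ⟨h1, h2⟩ := hρ k
    have hρ0 : 0 ≤ ρ k := hρlo.le.trans h1
    set P : ℝ := N k ((x k + ρ k • (f k (x k) - x k)) - y) with hP
    have hP0 : 0 ≤ P := (hN k).nonneg _
    have hPle : P ≤ N k (x k - y) := gauge_relaxStep_le (hN k) hρ0 (by linarith) (hfirm k (x k))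
    have hPsq : P ^ 2 ≤ s k - ρ k * (2 - ρ k) * r k :=
      gauge_relaxStep_sq_le (hN k) hρ0 (hfirm k (x k))
    have hcr : c * r k ≤ ρ k * (2 - ρ k) * r k :=
      mul_le_mul_of_nonneg_right (by nlinarith) (sq_nonneg _)
    -- `N_k(x^{k+1} − y) ≤ P + ρ_k ε_k`
    have e : x (k + 1) - y =
        ((x k + ρ k • (f k (x k) - x k)) - y) + ρ k • (w k - f k (x k)) := by
      rw [hx k]; module
    have hstep : N k (x (k + 1) - y) ≤ P + 2 * ε k := by
      rw [e]
      calc N k (((x k + ρ k • (f k (x k) - x k)) - y) + ρ k • (w k - f k (x k)))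
            ≤ P + N k (ρ k • (w k - f k (x k))) := (hN k).add_le _ _
        _ ≤ P + ρ k * ε k := by
              rw [(hN k).smul, abs_of_nonneg hρ0]
              exact add_le_add le_rfl (mul_le_mul_of_nonneg_left (hw k) hρ0)
        _ ≤ P + 2 * ε k := by nlinarith [hε k]
    have hsq1 : N k (x (k + 1) - y) ^ 2 ≤ (P + 2 * ε k) ^ 2 :=
      pow_le_pow_left₀ ((hN k).nonneg _) hstep 2
    have hPB : P ≤ B := hPle.trans (hB k)
    nlinarith [hε k, hεle k, mul_le_mul_of_nonneg_right hPB (hε k),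
      mul_le_mul_of_nonneg_right (hεle k) (hε k)]
  -- transport to the metric `N_{k+1}`
  have hrec : ∀ k, s (k + 1) + c * r k ≤ s k + (η k * B ^ 2 + (1 + S) * (4 * (B + Es) * ε k)) :=
    fun k => by
    have hm := hmono k (x (k + 1) - y)
    have h1 := hsq k
    have hsk : s k ≤ B ^ 2 := by
      simp only [hs]; exact pow_le_pow_left₀ ((hN k).nonneg _) (hB k) 2
    have he0 : 0 ≤ 4 * (B + Es) * ε k := mul_nonneg hBE (hε k)
    have hr0 : 0 ≤ c * r k := mul_nonneg hc0.le (sq_nonneg _)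
    have h3 := mul_le_mul_of_nonneg_left h1 (by linarith [hη k] : (0 : ℝ) ≤ 1 + η k)
    simp only [hs] at hsk ⊢
    nlinarith [mul_nonneg (hη k) hr0, mul_le_mul_of_nonneg_left hsk (hη k),
      mul_le_mul_of_nonneg_right (hηle k) he0]
  have herr : Summable fun k => η k * B ^ 2 + (1 + S) * (4 * (B + Es) * ε k) :=
    (hηs.mul_right _).add ((hεs.mul_left _).mul_left _)
  have herr0 : ∀ k, 0 ≤ η k * B ^ 2 + (1 + S) * (4 * (B + Es) * ε k) := fun k =>
    add_nonneg (mul_nonneg (hη k) (sq_nonneg _))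
      (mul_nonneg (by linarith) (mul_nonneg hBE (hε k)))
  have hsum : ∀ K, ∑ k ∈ Finset.range K, c * r k ≤
      s 0 + ∑' k, (η k * B ^ 2 + (1 + S) * (4 * (B + Es) * ε k)) := by
    intro K
    have htel : ∑ k ∈ Finset.range K, c * r k ≤
        s 0 - s K + ∑ k ∈ Finset.range K, (η k * B ^ 2 + (1 + S) * (4 * (B + Es) * ε k)) := by
      induction K with
      | zero => simp
      | succ K ih =>
        rw [Finset.sum_range_succ, Finset.sum_range_succ]
        linarith [hrec K]
    have h2 : 0 ≤ s K := sq_nonneg _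
    linarith [herr.sum_le_tsum (Finset.range K) (fun k _ => herr0 k)]
  have hs' : Summable fun k => c * r k :=
    summable_of_sum_range_le (fun k => mul_nonneg hc0.le (sq_nonneg _)) hsum
  have := hs'.mul_left c⁻¹
  simpa [hr, ← mul_assoc, inv_mul_cancel₀ hc0.ne'] using this

/-- **THE ENGINE WITH SUMMABLE ERRORS** ([EB92, Thm 3]'s `ε_k`, [CV13, Def 3.1]'s `ε_n`): as in
`exists_tendsto_of_firm_varGauge`, but the update uses an approximate evaluation `w^k` of `f_k(x^k)`
with `N_k(w^k − f_k x^k) ≤ ε_k`, `Σ ε_k < ∞`: `x^{k+1} = x^k + ρ_k (w^k − x^k)`. Then `x^k → x̄ ∈ F`.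
[cite: EcksteinBertsekas1992, §3 Thm 3] [cite: CombettesVu2013, §3 Prop 3.2 and Thm 3.3] -/
theorem exists_tendsto_of_firm_varGauge_inexact [ProperSpace E]
    (hN : ∀ k, IsEuclideanGauge (N k) m Mu) (hη : ∀ k, 0 ≤ η k) (hηs : Summable η)
    (hmono : ∀ k d, N (k + 1) d ^ 2 ≤ (1 + η k) * N k d ^ 2) (hF : F.Nonempty)
    (hfirm : ∀ k, ∀ y ∈ F, ∀ z, N k (f k z - y) ^ 2 + N k (z - f k z) ^ 2 ≤ N k (z - y) ^ 2)
    (hρlo : 0 < ρlo) (hρhi : ρhi < 2) (hρ : ∀ k, ρlo ≤ ρ k ∧ ρ k ≤ ρhi) (hε : ∀ k, 0 ≤ ε k)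
    (hεs : Summable ε) (hw : ∀ k, N k (w k - f k (x k)) ≤ ε k)
    (hx : ∀ k, x (k + 1) = x k + ρ k • (w k - x k))
    (hclos : ∀ (q : E) (φ : ℕ → ℕ), StrictMono φ → Tendsto (x ∘ φ) atTop (𝓝 q) →
      Tendsto (fun j => f (φ j) (x (φ j)) - x (φ j)) atTop (𝓝 0) → q ∈ F) :
    ∃ q ∈ F, Tendsto x atTop (𝓝 q) := by
  have hm : 0 < m := (hN 0).m_pos
  obtain ⟨y, hy⟩ := hF
  have hfy : ∀ k z, N k (f k z - y) ^ 2 + N k (z - f k z) ^ 2 ≤ N k (z - y) ^ 2 :=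
    fun k z => hfirm k y hy z
  -- residuals of the exact step tend to zero
  have hsum := summable_gauge_resid_sq_inexact hN hη hηs hmono hρlo hρhi hρ hε hεs hw hx hfy
  have hres : Tendsto (fun k => f k (x k) - x k) atTop (𝓝 0) := by
    have h0 : Tendsto (fun k => N k (f k (x k) - x k)) atTop (𝓝 0) := by
      have := hsum.tendsto_atTop_zero.sqrt
      simpa [Real.sqrt_sq ((hN _).nonneg _)] using this
    rw [tendsto_iff_norm_sub_tendsto_zero]
    simp only [sub_zero]
    refine squeeze_zero (fun k => norm_nonneg _) (fun k => (hN k).norm_le _) ?_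
    have := h0.div_const m
    rwa [zero_div] at this
  -- boundedness and a cluster point
  obtain ⟨B, hB0, hB⟩ := gauge_inexact_bound hN hη hηs hmono hρlo.le hρhi.le hρ hε hεs hw hx hfy
  have hbd : ∀ k, x k ∈ Metric.closedBall y (B / m) := fun k => by
    rw [Metric.mem_closedBall, dist_eq_norm]
    exact ((hN k).norm_le _).trans (div_le_div_of_nonneg_right (hB k) hm.le)
  obtain ⟨q, -, φ, hφ, hlim⟩ := tendsto_subseq_of_bounded Metric.isBounded_closedBall hbd
  have hq : q ∈ F := hclos q φ hφ hlim (hres.comp hφ.tendsto_atTop)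
  -- quasi-Fejér towards `q`, with summable errors
  have hfq : ∀ k z, N k (f k z - q) ^ 2 + N k (z - f k z) ^ 2 ≤ N k (z - q) ^ 2 :=
    fun k z => hfirm k q hq z
  set S : ℝ := ∑' i, η i with hS
  have hηle : ∀ k, η k ≤ S := fun k => hηs.le_tsum k (fun j _ => hη j)
  set ε' : ℕ → ℝ := fun k => 2 * (1 + η k) * ε k with hε'
  have hε'0 : ∀ k, 0 ≤ ε' k := fun k => mul_nonneg (mul_nonneg zero_le_two (by linarith [hη k])) (hε k)
  have hε's : Summable ε' := by
    refine Summable.of_nonneg_of_le hε'0 (fun k => ?_) ((hεs.mul_left (2 * (1 + S))))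
    simp only [hε']
    have := hηle k
    nlinarith [hε k]
  have hrec : ∀ k, N (k + 1) (x (k + 1) - q) ≤ (1 + η k) * N k (x k - q) + ε' k := fun k =>
    gauge_inexact_succ_le_mul hN hη hmono hρlo.le hρhi.le hρ hε hw hx hfq k
  have hsub : Tendsto ((fun k => N k (x k - q)) ∘ φ) atTop (𝓝 0) := by
    have h1 : Tendsto (fun j => ‖x (φ j) - q‖) atTop (𝓝 0) :=
      tendsto_iff_norm_sub_tendsto_zero.1 hlim
    have h2 : Tendsto (fun j => Mu * ‖x (φ j) - q‖) atTop (𝓝 0) := by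
      simpa using h1.const_mul Mu
    exact squeeze_zero (fun j => (hN _).nonneg _) (fun j => (hN (φ j)).upper _) h2
  have ha0 : Tendsto (fun k => N k (x k - q)) atTop (𝓝 0) :=
    tendsto_zero_of_le_mul_add (fun k => (hN k).nonneg _) hη hε'0 hηs hε's hrec hφ hsub
  refine ⟨q, hq, ?_⟩
  rw [tendsto_iff_norm_sub_tendsto_zero]
  refine squeeze_zero (fun k => norm_nonneg _) (fun k => (hN k).norm_le _) ?_
  have := ha0.div_const m
  rwa [zero_div] at this

/-- **[EB92, THEOREM 3] with summable resolvent errors** (finite dimension / proper space, gauge form):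
`f` continuous and firmly quasi-nonexpansive in an equivalent Euclidean gauge `N` towards its nonempty
fixed-point set, `z^{k+1} = (1−ρ_k)z^k + ρ_k w^k` with `N(w^k − f z^k) ≤ ε_k`, `Σ ε_k < ∞`,
`0 < ρlo ≤ ρ_k ≤ ρhi < 2` ⇒ `z^k →` a fixed point of `f` ("Rockafellar's convergence theorem also allows
the resolvents `J_{c_kT}` to be evaluated approximately, so long as the sum of all errors is finite").
[cite: EcksteinBertsekas1992, §3 Thm 3] -/
theorem exists_tendsto_relaxed_of_firm_inexact [ProperSpace E] {N : E → ℝ} (hN : IsEuclideanGauge N m Mu)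
    {f : E → E} (hf : Continuous f)
    (hfirm : ∀ y ∈ Function.fixedPoints f, ∀ z, N (f z - y) ^ 2 + N (z - f z) ^ 2 ≤ N (z - y) ^ 2)
    (hne : (Function.fixedPoints f).Nonempty) (hρlo : 0 < ρlo) (hρhi : ρhi < 2)
    (hρ : ∀ k, ρlo ≤ ρ k ∧ ρ k ≤ ρhi) (hε : ∀ k, 0 ≤ ε k) (hεs : Summable ε)
    (hw : ∀ k, N (w k - f (x k)) ≤ ε k) (hx : ∀ k, x (k + 1) = x k + ρ k • (w k - x k)) :
    ∃ q ∈ Function.fixedPoints f, Tendsto x atTop (𝓝 q) := by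
  refine exists_tendsto_of_firm_varGauge_inexact (N := fun _ => N) (η := fun _ => 0) (f := fun _ => f)
    (fun _ => hN) (fun _ => le_rfl) summable_zero (fun k d => by simp) hne
    (fun k y hy z => hfirm y hy z) hρlo hρhi hρ hε hεs hw hx ?_
  intro q φ hφ hlim hres
  have h1 : Tendsto (fun j => f (x (φ j)) - x (φ j)) atTop (𝓝 (f q - q)) :=
    ((hf.sub continuous_id).tendsto q).comp hlim
  have h2 : f q - q = 0 := tendsto_nhds_unique h1 hres
  exact Function.mem_fixedPoints.2 (sub_eq_zero.1 h2)

end Inexact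

section InexactPDHG

open Literature.Analysis.Convex.MonotoneOperator (IsMonotone IsResolventMap zer)
open Literature.Analysis.Convex.PrimalDualHybridGradient
open Literature.Analysis.Convex.RestartedPDHG
open Literature.Analysis.Convex.AndersonAccelerationPDHG (isEuclideanGauge_normM normM_pdhgStep_firm)

variable {X Y : Type*} [NormedAddCommGroup X] [InnerProductSpace ℝ X] [CompleteSpace X]
  [NormedAddCommGroup Y] [InnerProductSpace ℝ Y] [CompleteSpace Y]

/-- **Over-relaxed PDHG with INEXACT steps converges** ([EB92, Thm 3] for the proximal-point form of
PDHG in `M_{τ,σ}`): finite-dimensional `X`, `Y`; `A`, `B` monotone with resolvent maps; fixed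
`τσ‖K‖² < 1`; a saddle point exists; `ρ_k ∈ [ρlo, ρhi] ⊂ (0,2)`; the update uses approximate PD points
`w^k` with `‖w^k − PD_{τ,σ}(z^k)‖ ≤ ε_k` IN THE NORM OF `X × Y` (e.g. inexactly evaluated projections),
`Σ ε_k < ∞`, `z^{k+1} = z^k + ρ_k (w^k − z^k)` ⇒ `z^k →` a saddle point.
[cite: EcksteinBertsekas1992, §3 Thm 3 (ε_k)] [cite: ChambollePock2015, §3 (12) and §4.1 Algorithm 2] -/
theorem tendsto_of_inexact_relaxedPdhg [FiniteDimensional ℝ X] [FiniteDimensional ℝ Y] (K : X →L[ℝ] Y)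
    {A : Set (X × X)} {B : Set (Y × Y)} {τ σ : ℝ} (hτ : 0 < τ) (hσ : 0 < σ)
    (hK : τ * σ * ‖K‖ ^ 2 < 1) (hA : IsMonotone A) (hB : IsMonotone B) {jA : X → X} {jB : Y → Y}
    (hjA : IsResolventMap τ A jA) (hjB : IsResolventMap σ B jB) (hsad : (zer (kkt K A B)).Nonempty)
    {ρ : ℕ → ℝ} {ρlo ρhi : ℝ} (hρlo : 0 < ρlo) (hρhi : ρhi < 2) (hρ : ∀ k, ρlo ≤ ρ k ∧ ρ k ≤ ρhi)
    {ε : ℕ → ℝ} (hε : ∀ k, 0 ≤ ε k) (hεs : Summable ε) {z w : ℕ → X × Y}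
    (hw : ∀ k, ‖w k - pdhgStep K τ σ jA jB (z k)‖ ≤ ε k)
    (hz : ∀ k, z (k + 1) = z k + ρ k • (w k - z k)) :
    ∃ zs : X × Y, WithLp.toLp 2 zs ∈ zer (kkt K A B) ∧ Tendsto z atTop (𝓝 zs) := by
  have hN := isEuclideanGauge_normM K hτ hσ hK
  set Mu : ℝ := Real.sqrt (τ⁻¹ + σ⁻¹ + 2 * ‖K‖) with hMu
  have hfix : ∀ u : X × Y, u ∈ Function.fixedPoints (pdhgStep K τ σ jA jB) ↔
      WithLp.toLp 2 u ∈ zer (kkt K A B) := fun u =>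
    (pdhgStep_eq_self_iff K hτ hσ hA hB hjA hjB u)
  obtain ⟨ps, hps⟩ := hsad
  have hne : (Function.fixedPoints (pdhgStep K τ σ jA jB)).Nonempty :=
    ⟨WithLp.ofLp ps, (hfix _).2 (by simpa using hps)⟩
  have hfirm : ∀ y ∈ Function.fixedPoints (pdhgStep K τ σ jA jB), ∀ u,
      normM K τ σ (pdhgStep K τ σ jA jB u - y) ^ 2 +
          normM K τ σ (u - pdhgStep K τ σ jA jB u) ^ 2 ≤ normM K τ σ (u - y) ^ 2 := fun y hy u =>
    normM_pdhgStep_firm K hτ hσ hK.le hA hB hjA hjB ((hfix y).1 hy) u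
  have hw' : ∀ k, normM K τ σ (w k - pdhgStep K τ σ jA jB (z k)) ≤ Mu * ε k := fun k =>
    (hN.upper _).trans (mul_le_mul_of_nonneg_left (hw k) hN.Mu_nonneg)
  obtain ⟨zs, hzs, hlim⟩ := exists_tendsto_relaxed_of_firm_inexact (x := z) (w := w)
    (ε := fun k => Mu * ε k) hN (continuous_pdhgStep K hτ hσ hA hB hjA hjB) hfirm hne hρlo hρhi hρ
    (fun k => mul_nonneg hN.Mu_nonneg (hε k)) (hεs.mul_left Mu) hw' hz
  exact ⟨zs, (hfix zs).1 hzs, hlim⟩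

end InexactPDHG

section InexactDR

open Literature.Analysis.Convex.MonotoneOperator
open Literature.Analysis.Convex.DouglasRachford
open Literature.Analysis.Convex.AndersonAccelerationPDHG (isEuclideanGauge_norm norm_drStep_firm)

variable {H : Type*} [NormedAddCommGroup H] [InnerProductSpace ℝ H]

/-- **[EB92, THEOREM 7] — the generalized Douglas–Rachford splitting method with relaxation factors
AND approximate resolvents**, on a proper (e.g. finite-dimensional) space with strong convergence:
`A`, `B` monotone with resolvent maps `J_{λA}`, `J_{λB}` (`λ > 0`), `zer(A + B) ≠ ∅`,
`‖u^k − J_{λB}(z^k)‖ ≤ β_k`, `‖v^{k+1} − J_{λA}(2u^k − z^k)‖ ≤ α_k`, `z^{k+1} = z^k + ρ_k (v^{k+1} − u^k)`,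
`Σ α_k < ∞`, `Σ β_k < ∞`, `0 < ρlo ≤ ρ_k ≤ ρhi < 2` ⇒ `z^k → z*` with `G(z*) = z*` and
`J_{λB} z* ∈ zer(A + B)` (the tree's `exists_tendsto_kmIter_drStep` is the case `α_k = β_k = 0`, constant
`ρ`). Mechanism: `w^k = z^k + v^{k+1} − u^k` is within `α_k + 3β_k` of `G(z^k)` (nonexpansiveness of
`J_{λA}`), and `G` is firmly nonexpansive [EB92, Cor 4.1]. [cite: EcksteinBertsekas1992, §4 Thm 7] -/
theorem exists_tendsto_of_inexact_drIter [ProperSpace H] {γ : ℝ} {A B : Set (H × H)} {ja jb : H → H}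
    (hja : IsResolventMap γ A ja) (hjb : IsResolventMap γ B jb) (hA : IsMonotone A)
    (hB : IsMonotone B) (hγ : 0 < γ) (hzer : (zer (opSum A B)).Nonempty) {ρ : ℕ → ℝ} {ρlo ρhi : ℝ}
    (hρlo : 0 < ρlo) (hρhi : ρhi < 2) (hρ : ∀ k, ρlo ≤ ρ k ∧ ρ k ≤ ρhi) {α β : ℕ → ℝ}
    (hα : ∀ k, 0 ≤ α k) (hβ : ∀ k, 0 ≤ β k) (hαs : Summable α) (hβs : Summable β)
    {z u v : ℕ → H} (hu : ∀ k, ‖u k - jb (z k)‖ ≤ β k)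
    (hv : ∀ k, ‖v (k + 1) - ja ((2 : ℝ) • u k - z k)‖ ≤ α k)
    (hz : ∀ k, z (k + 1) = z k + ρ k • (v (k + 1) - u k)) :
    ∃ zs : H, drStep ja jb zs = zs ∧ jb zs ∈ zer (opSum A B) ∧ Tendsto z atTop (𝓝 zs) ∧
      Tendsto (fun k => jb (z k)) atTop (𝓝 (jb zs)) := by
  obtain ⟨x, hx⟩ := hzer
  obtain ⟨p, hp, -⟩ := exists_drStep_eq_self_of_mem_zer hja hjb hA hB hγ hx
  have hne : (Function.fixedPoints (drStep ja jb)).Nonempty := ⟨p, hp⟩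
  have hcont : Continuous (drStep ja jb) :=
    (LipschitzWith.of_dist_le_mul (K := 1) fun a b => by
      simpa [dist_eq_norm] using norm_drStep_sub_le hja hjb hA hB hγ b a).continuous
  have hfirm : ∀ y ∈ Function.fixedPoints (drStep ja jb), ∀ q,
      ‖drStep ja jb q - y‖ ^ 2 + ‖q - drStep ja jb q‖ ^ 2 ≤ ‖q - y‖ ^ 2 := fun y hy q =>
    norm_drStep_firm hja hjb hA hB hγ hy q
  -- the composite approximate step `w^k = z^k + v^{k+1} − u^k`
  set w : ℕ → H := fun k => z k + (v (k + 1) - u k) with hw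
  have hwerr : ∀ k, ‖w k - drStep ja jb (z k)‖ ≤ α k + 3 * β k := fun k => by
    have e : w k - drStep ja jb (z k) =
        (v (k + 1) - ja ((2 : ℝ) • u k - z k)) +
          (ja ((2 : ℝ) • u k - z k) - ja ((2 : ℝ) • jb (z k) - z k)) - (u k - jb (z k)) := by
      simp only [hw, drStep]; abel
    rw [e]
    have h1 : ‖ja ((2 : ℝ) • u k - z k) - ja ((2 : ℝ) • jb (z k) - z k)‖ ≤ 2 * β k := by
      refine (hja.norm_sub_le hA hγ _ _).trans ?_
      have e2 : (2 : ℝ) • u k - z k - ((2 : ℝ) • jb (z k) - z k) = (2 : ℝ) • (u k - jb (z k)) := by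
        module
      rw [e2, norm_smul, Real.norm_eq_abs, abs_of_pos two_pos]
      exact mul_le_mul_of_nonneg_left (hu k) zero_le_two
    calc ‖(v (k + 1) - ja ((2 : ℝ) • u k - z k)) +
            (ja ((2 : ℝ) • u k - z k) - ja ((2 : ℝ) • jb (z k) - z k)) - (u k - jb (z k))‖
          ≤ ‖(v (k + 1) - ja ((2 : ℝ) • u k - z k)) +
              (ja ((2 : ℝ) • u k - z k) - ja ((2 : ℝ) • jb (z k) - z k))‖ + ‖u k - jb (z k)‖ :=
            norm_sub_le _ _
      _ ≤ (‖v (k + 1) - ja ((2 : ℝ) • u k - z k)‖ +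
              ‖ja ((2 : ℝ) • u k - z k) - ja ((2 : ℝ) • jb (z k) - z k)‖) + ‖u k - jb (z k)‖ :=
            add_le_add (norm_add_le _ _) le_rfl
      _ ≤ (α k + 2 * β k) + β k := add_le_add (add_le_add (hv k) h1) (hu k)
      _ = α k + 3 * β k := by ring
  have hz' : ∀ k, z (k + 1) = z k + ρ k • (w k - z k) := fun k => by
    rw [hz k]; simp only [hw]; abel_nf
  obtain ⟨zs, hzs, hlim⟩ := exists_tendsto_relaxed_of_firm_inexact (x := z) (w := w)
    (ε := fun k => α k + 3 * β k) (isEuclideanGauge_norm (F := H)) hcont hfirm hne hρlo hρhi hρ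
    (fun k => by linarith [hα k, hβ k]) (hαs.add (hβs.mul_left 3)) hwerr hz'
  have hzs' : drStep ja jb zs = zs := hzs
  exact ⟨zs, hzs', apply_mem_zer_opSum_of_drStep_eq_self hja hjb hA hB hγ hzs', hlim,
    ((hjb.continuous hB hγ).tendsto zs).comp hlim⟩

end InexactDR

/-! ## §7 The ergodic `O(1/N)` gap under variable steps ([GLYEB, Thm 2]-type bound, conic case, with a
constant relaxation factor) -/

section ErgodicVariable

open Literature.Analysis.Convex.MonotoneOperator (IsMonotone IsResolventMap zer)
open Literature.Analysis.Convex.PrimalDualHybridGradient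
open Literature.Analysis.Convex.RestartedPDHG
open Literature.Analysis.Convex.DouglasRachford (normalCone)

variable {X Y : Type*} [NormedAddCommGroup X] [InnerProductSpace ℝ X] [CompleteSpace X]
  [NormedAddCommGroup Y] [InnerProductSpace ℝ Y] [CompleteSpace Y]

/-- The PD points of the variable-step scheme: `ζ^{n+1} = PD_{τ_n,σ_n}(z^n)` (value at `0` a
placeholder). [cite: GoldsteinEtAl2013, §2 Algorithm 1] [cite: ChambollePock2015, §4.1 Algorithm 2 (22)] -/
noncomputable def varPdhgPoint (K : X →L[ℝ] Y) (τ σ ρ : ℕ → ℝ) (jA : ℕ → X → X) (jB : ℕ → Y → Y)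
    (z₀ : X × Y) : ℕ → X × Y
  | 0 => z₀
  | n + 1 => pdhgStep K (τ n) (σ n) (jA n) (jB n) (varPdhgIter K τ σ ρ jA jB z₀ n)

/-- **Ergodic `O(1/N)` primal–dual gap under VARIABLE steps** ([GLYEB, Thm 2]-type statement for the
constrained bilinear saddle, with a constant relaxation factor `0 < ρ ≤ 2` as in [CP16, Thm 2]): if the
metrics satisfy `M_k ⪰ 0` (`τ_kσ_k‖K‖² ≤ 1`) and `‖d‖²_{M_{k+1}} ≤ (1+κ_k)‖d‖²_{M_k}` (`κ_k ≥ 0`; under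
conditions (A)(B)(C1) one may take `κ_k = 2φ_k/(1−√ℓ)` from the index where `φ_k ≤ ½`, `qM_succ_le`), and
the iterates stay at bounded `M_k`-distance from the test point `(x, y) ∈ C × D`
(`‖z^k − (x,y)‖²_{M_k} ≤ Dmax` — [GLYEB]'s constants `C_U`, `C_H`), then for `N ≥ 1`
`L(X_N, y) − L(x, Y_N) ≤ (‖z⁰ − (x,y)‖²_{M_0} + Dmax·Σ_{k<N} κ_k) / (2ρN)`,
`X_N`, `Y_N` the averages of the PD points `ζ^1..ζ^N`. With constant steps (`κ ≡ 0`) this is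
[CP16, Thm 2] (`conicL_gap_ergodic_relaxed_le`, constant `ρ`). The printed [GLYEB, Thm 2] is the VI
form `φ(u) − φ(ũ_t) + (u − ũ_t)ᵀQ(ũ_t) ≥ −[‖u−u_0‖²_{M_0} + C_φC_U + C_φC_H‖u−u*‖²]/(2t)` with
`ρ = 1`. [cite: GoldsteinEtAl2013, §6.7 Theorem 2] [cite: ChambollePock2015, §4.1 Theorem 2] -/
theorem conicL_gap_ergodic_var_le (K : X →L[ℝ] Y) {C : Set X} {D : Set Y} (c : X) (b : Y)
    {τ σ : ℕ → ℝ} (hτ : ∀ k, 0 < τ k) (hσ : ∀ k, 0 < σ k) (hK : ∀ k, τ k * σ k * ‖K‖ ^ 2 ≤ 1)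
    {jA : ℕ → X → X} {jB : ℕ → Y → Y}
    (hjA : ∀ k, IsResolventMap (τ k) (shiftOp c (normalCone C)) (jA k))
    (hjB : ∀ k, IsResolventMap (σ k) (shiftOp b (normalCone D)) (jB k)) {ρ : ℝ} (hρ0 : 0 < ρ)
    (hρ2 : ρ ≤ 2) {κ : ℕ → ℝ} (hκ : ∀ k, 0 ≤ κ k)
    (hmono : ∀ k d, qM K (τ (k + 1)) (σ (k + 1)) d ≤ (1 + κ k) * qM K (τ k) (σ k) d) (z₀ : X × Y)
    {ξ : X} (hξ : ξ ∈ C) {η : Y} (hη : η ∈ D) {Dmax : ℝ}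
    (hD : ∀ k, qM K (τ k) (σ k) (varPdhgIter K τ σ (fun _ => ρ) jA jB z₀ k - (ξ, η)) ≤ Dmax)
    {N : ℕ} (hN : N ≠ 0) :
    conicL K c b (xAvg (varPdhgPoint K τ σ (fun _ => ρ) jA jB z₀) N) η -
        conicL K c b ξ (yAvg (varPdhgPoint K τ σ (fun _ => ρ) jA jB z₀) N) ≤
      (qM K (τ 0) (σ 0) (z₀ - (ξ, η)) + Dmax * ∑ k ∈ Finset.range N, κ k) / (2 * ρ * N) := by
  set z := varPdhgIter K τ σ (fun _ => ρ) jA jB z₀ with hz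
  set ζ := varPdhgPoint K τ σ (fun _ => ρ) jA jB z₀ with hζ
  have hζsucc : ∀ n, ζ (n + 1) = pdhgStep K (τ n) (σ n) (jA n) (jB n) (z n) := fun n => rfl
  set Dk : ℕ → ℝ := fun k => qM K (τ k) (σ k) (z k - (ξ, η)) with hDk
  set gap : ℕ → ℝ := fun n => conicL K c b (ζ (n + 1)).1 η - conicL K c b ξ (ζ (n + 1)).2 with hgap
  have hDnn : ∀ k, 0 ≤ Dk k := fun k => qM_nonneg K (hτ k) (hσ k) (hK k) _
  have hDmax0 : 0 ≤ Dmax := (hDnn 0).trans (hD 0)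
  -- per-step: `2ρ gap_k ≤ Dk k − Dk (k+1) + κ_k Dmax`
  have hstep : ∀ k, 2 * ρ * gap k ≤ Dk k - Dk (k + 1) + κ k * Dmax := fun k => by
    have h := conicL_relaxed_step_le K c b (hτ k) (hσ k) (hjA k) (hjB k) hρ0.le (z k) hξ hη
    have hsucc : z (k + 1) = z k + ρ • (pdhgStep K (τ k) (σ k) (jA k) (jB k) (z k) - z k) := by
      rw [hz, varPdhgIter_succ]
    rw [← hsucc] at h
    have hnn : 0 ≤ 2⁻¹ * (ρ * (2 - ρ)) *
        qM K (τ k) (σ k) (pdhgStep K (τ k) (σ k) (jA k) (jB k) (z k) - z k) :=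
      mul_nonneg (mul_nonneg (by norm_num) (mul_nonneg hρ0.le (by linarith)))
        (qM_nonneg K (hτ k) (hσ k) (hK k) _)
    -- metric switch at the point `z^{k+1}`
    have hm := hmono k (z (k + 1) - (ξ, η))
    have hq0 : 0 ≤ qM K (τ k) (σ k) (z (k + 1) - (ξ, η)) := qM_nonneg K (hτ k) (hσ k) (hK k) _
    have hDk1 : Dk (k + 1) ≤ (1 + κ k) * qM K (τ k) (σ k) (z (k + 1) - (ξ, η)) := hm
    have hDle : Dk (k + 1) ≤ Dmax := hD (k + 1)
    simp only [hgap, hDk, hζsucc] at hDk1 hDle ⊢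
    nlinarith [mul_le_mul_of_nonneg_left hDle (hκ k), mul_nonneg (hκ k) hq0,
      mul_le_mul_of_nonneg_left (hDnn (k + 1)) (hκ k)]
  -- telescope
  have htel : ∀ N, 2 * ρ * ∑ k ∈ Finset.range N, gap k ≤
      Dk 0 - Dk N + Dmax * ∑ k ∈ Finset.range N, κ k := by
    intro N
    induction N with
    | zero => simp
    | succ N ih =>
      rw [Finset.sum_range_succ, Finset.sum_range_succ, mul_add]
      have := hstep N
      linarith
  have hsum : ∑ k ∈ Finset.range N, gap k ≤
      (Dk 0 + Dmax * ∑ k ∈ Finset.range N, κ k) / (2 * ρ) := by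
    rw [le_div_iff₀ (by linarith), mul_comm]
    linarith [htel N, hDnn N]
  -- averages
  have hN' : (0 : ℝ) < N := Nat.cast_pos.mpr (Nat.pos_of_ne_zero hN)
  rw [conicL_xAvg K c b ζ hN η, conicL_yAvg K c b ζ hN ξ, ← mul_sub, ← Finset.sum_sub_distrib]
  have hz0 : Dk 0 = qM K (τ 0) (σ 0) (z₀ - (ξ, η)) := by simp [hDk, hz, varPdhgIter]
  rw [← hz0]
  calc (N : ℝ)⁻¹ * ∑ n ∈ Finset.range N, gap n
        ≤ (N : ℝ)⁻¹ * ((Dk 0 + Dmax * ∑ k ∈ Finset.range N, κ k) / (2 * ρ)) :=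
        mul_le_mul_of_nonneg_left hsum (inv_nonneg.mpr hN'.le)
    _ = (Dk 0 + Dmax * ∑ k ∈ Finset.range N, κ k) / (2 * ρ * N) := by
        field_simp

end ErgodicVariable

/-! ## §8 The PDHG step is firmly nonexpansive in `‖·‖_M` between ANY two points (the resolvent
property of the proximal-point form [CP16, (12)]; the tree had the quasi form towards saddle points) -/

section TwoPoint

open Literature.Analysis.Convex.MonotoneOperator (IsMonotone IsResolventMap zer)
open Literature.Analysis.Convex.PrimalDualHybridGradient
open Literature.Analysis.Convex.RestartedPDHG

variable {X Y : Type*} [NormedAddCommGroup X] [InnerProductSpace ℝ X] [CompleteSpace X]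
  [NormedAddCommGroup Y] [InnerProductSpace ℝ Y] [CompleteSpace Y]

/-- **Two-point firm nonexpansiveness of the PDHG step in `M_{τ,σ}`** (`τσ‖K‖² ≤ 1`, monotone `A`, `B`
with resolvent maps): for all `u, v`,
`‖PD u − PD v‖²_M + ‖(u − PD u) − (v − PD v)‖²_M ≤ ‖u − v‖²_M` — one PDHG step is the resolvent of the
monotone KKT operator in the `M`-geometry [CP16, (12)], and resolvents of monotone operators are firmly
nonexpansive [EB92, Thm 2]. (The tree's `fejer_step` / `normM_pdhgStep_firm` is the case `v =` a saddle
point.) [cite: ChambollePock2015, §3 (12)–(13)] [cite: EcksteinBertsekas1992, §2 Thm 2] -/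
theorem normM_pdhgStep_two_point (K : X →L[ℝ] Y) {A : Set (X × X)} {B : Set (Y × Y)} {τ σ : ℝ}
    (hτ : 0 < τ) (hσ : 0 < σ) (hK : τ * σ * ‖K‖ ^ 2 ≤ 1) (hA : IsMonotone A) (hB : IsMonotone B)
    {jA : X → X} {jB : Y → Y} (hjA : IsResolventMap τ A jA) (hjB : IsResolventMap σ B jB)
    (u v : X × Y) :
    normM K τ σ (pdhgStep K τ σ jA jB u - pdhgStep K τ σ jA jB v) ^ 2 +
        normM K τ σ ((u - pdhgStep K τ σ jA jB u) - (v - pdhgStep K τ σ jA jB v)) ^ 2 ≤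
      normM K τ σ (u - v) ^ 2 := by
  set Tu := pdhgStep K τ σ jA jB u with hTu
  set Tv := pdhgStep K τ σ jA jB v with hTv
  have hu := pdhgStep_mem_kkt K hτ.ne' hσ.ne' hjA hjB u
  have hv := pdhgStep_mem_kkt K hτ.ne' hσ.ne' hjA hjB v
  -- monotonicity of the KKT operator at the two pairs
  have hmono : 0 ≤ ⟪WithLp.toLp 2 Tu - WithLp.toLp 2 Tv,
      metricM K τ σ (WithLp.toLp 2 u - WithLp.toLp 2 Tu) -
        metricM K τ σ (WithLp.toLp 2 v - WithLp.toLp 2 Tv)⟫ := isMonotone_kkt K hA hB hv hu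
  rw [← metricM_sub] at hmono
  set a : WithLp 2 (X × Y) := WithLp.toLp 2 Tu - WithLp.toLp 2 Tv with ha
  set d : WithLp 2 (X × Y) := (WithLp.toLp 2 u - WithLp.toLp 2 Tu) - (WithLp.toLp 2 v - WithLp.toLp 2 Tv)
    with hd
  have hsum : WithLp.toLp 2 u - WithLp.toLp 2 v = a + d := by simp only [ha, hd]; abel
  have hexp := inner_metricM_self_add K τ σ a d
  rw [normM_sq K hτ hσ hK, normM_sq K hτ hσ hK, normM_sq K hτ hσ hK, qM_eq, qM_eq, qM_eq,
    WithLp.toLp_sub, WithLp.toLp_sub, WithLp.toLp_sub, WithLp.toLp_sub, WithLp.toLp_sub, hsum, hexp]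
  have e1 : (WithLp.toLp 2 u - WithLp.toLp 2 Tu) - (WithLp.toLp 2 v - WithLp.toLp 2 Tv) = d := rfl
  have e2 : WithLp.toLp 2 Tu - WithLp.toLp 2 Tv = a := rfl
  rw [e1, e2]
  linarith

/-- Consequently the PDHG step is nonexpansive in `‖·‖_M`: `‖PD u − PD v‖_M ≤ ‖u − v‖_M` (the
hypothesis under which Halpern / Krasnosel'skiĭ–Mann / Anderson-type schemes are analysed in the
`M`-geometry). [cite: ChambollePock2015, §3 (12)–(13)] [cite: ApplegateEtAl2022, Proposition 2 (i)] -/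
theorem normM_pdhgStep_sub_pdhgStep_le (K : X →L[ℝ] Y) {A : Set (X × X)} {B : Set (Y × Y)} {τ σ : ℝ}
    (hτ : 0 < τ) (hσ : 0 < σ) (hK : τ * σ * ‖K‖ ^ 2 ≤ 1) (hA : IsMonotone A) (hB : IsMonotone B)
    {jA : X → X} {jB : Y → Y} (hjA : IsResolventMap τ A jA) (hjB : IsResolventMap σ B jB)
    (u v : X × Y) :
    normM K τ σ (pdhgStep K τ σ jA jB u - pdhgStep K τ σ jA jB v) ≤ normM K τ σ (u - v) := by
  have h := normM_pdhgStep_two_point K hτ hσ hK hA hB hjA hjB u v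
  have h2 : 0 ≤ normM K τ σ ((u - pdhgStep K τ σ jA jB u) - (v - pdhgStep K τ σ jA jB v)) ^ 2 :=
    sq_nonneg _
  exact (pow_le_pow_iff_left₀ (normM_nonneg K τ σ _) (normM_nonneg K τ σ _) two_ne_zero).1
    (by linarith)

end TwoPoint

/-! ## §9 Ratcheted (monotone) primal-weight schedules satisfy condition (B) automatically -/

section Ratchet

open Literature.Analysis.Convex.MonotoneOperator (IsMonotone IsResolventMap zer)
open Literature.Analysis.Convex.PrimalDualHybridGradient

/-- A non-increasing real sequence bounded below has summable variation:
`Σ_k |ω_{k+1} − ω_k| ≤ ω_0 − ωlo`. (The telescoping step behind "a RATCHETED primal weight — once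
engaged, `ω` may only decrease — with a positive floor satisfies [GLYEB]'s summability condition (B)
with no further assumption".) [cite: GoldsteinEtAl2013, §6.2 condition (B) and §6.3 (geometric ⇒ summable)] -/
theorem summable_abs_sub_of_antitone {ω : ℕ → ℝ} (hω : Antitone ω) {ωlo : ℝ} (hlo : ∀ k, ωlo ≤ ω k) :
    Summable fun k => |ω (k + 1) - ω k| := by
  have hnn : ∀ k, 0 ≤ |ω (k + 1) - ω k| := fun k => abs_nonneg _
  refine summable_of_sum_range_le hnn (c := ω 0 - ωlo) fun K => ?_
  have htel : ∀ K, ∑ k ∈ Finset.range K, |ω (k + 1) - ω k| = ω 0 - ω K := by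
    intro K
    induction K with
    | zero => simp
    | succ K ih =>
      rw [Finset.sum_range_succ, ih, abs_of_nonpos (by linarith [hω (Nat.le_succ K)])]
      ring
  rw [htel K]
  linarith [hlo K]

variable {X Y : Type*} [NormedAddCommGroup X] [InnerProductSpace ℝ X] [CompleteSpace X]
  [NormedAddCommGroup Y] [InnerProductSpace ℝ Y] [CompleteSpace Y]

/-- **A RATCHETED primal weight is covered by [GLYEB, Thm 1]**: `τ_k = s/ω_k`, `σ_k = s·ω_k` with
`s²‖K‖² < 1`, `ω` NON-INCREASING and `ω_k ≥ ωlo > 0` (e.g. "once the residual test passes at a restart,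
`ω` may only decrease", with a floor) ⇒ conditions (A), (B), (C1) hold with NO summability hypothesis to
check, so the variable-step (relaxed) PDHG iterates converge to a saddle point (finite dimension, monotone
`A`, `B` with resolvent maps, `ρ_k ∈ [ρlo, ρhi] ⊂ (0,2)`, a saddle point exists). The step size `s` is
FIXED here; an adaptively re-tuned `s` is not covered. [cite: GoldsteinEtAl2013, §6.2 (A) (B) (C1) and §6.7 Theorem 1]
[cite: CombettesVu2013, §3 Thm 3.3] -/
theorem tendsto_varPdhgIter_primalWeight_antitone [FiniteDimensional ℝ X] [FiniteDimensional ℝ Y]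
    (K : X →L[ℝ] Y) {A : Set (X × X)} {B : Set (Y × Y)} (hA : IsMonotone A) (hB : IsMonotone B)
    {s : ℝ} (hs : 0 < s) (hsK : s ^ 2 * ‖K‖ ^ 2 < 1) {ω : ℕ → ℝ} (hω : Antitone ω) {ωlo : ℝ}
    (hωlo : 0 < ωlo) (hlo : ∀ k, ωlo ≤ ω k) {ρ : ℕ → ℝ} {jA : ℕ → X → X} {jB : ℕ → Y → Y}
    (hjA : ∀ k, IsResolventMap (s / ω k) A (jA k)) (hjB : ∀ k, IsResolventMap (s * ω k) B (jB k))
    {ρlo ρhi : ℝ} (hρlo : 0 < ρlo) (hρhi : ρhi < 2) (hρ : ∀ k, ρlo ≤ ρ k ∧ ρ k ≤ ρhi)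
    (hsad : (zer (kkt K A B)).Nonempty) (z₀ : X × Y) :
    ∃ zs : X × Y, WithLp.toLp 2 zs ∈ zer (kkt K A B) ∧
      Tendsto (varPdhgIter K (fun k => s / ω k) (fun k => s * ω k) ρ jA jB z₀) atTop (𝓝 zs) :=
  tendsto_varPdhgIter_primalWeight K hA hB hs hsK hωlo (fun k => ⟨hlo k, hω (Nat.zero_le k)⟩)
    (summable_abs_sub_of_antitone hω hlo) hjA hjB hρlo hρhi hρ hsad z₀

end Ratchet

end Literature.Analysis.Convex.RelaxedPDHG
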